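import Mathlib.Analysis.MeanInequalities
import Mathlib.Analysis.SpecialFunctions.Pow.Real
import Mathlib.Analysis.SpecialFunctions.Log.Basic
import Mathlib.Algebra.Order.BigOperators.Ring.Finset
import Mathlib.Algebra.BigOperators.Ring.Finset
import Mathlib.Data.Fintype.Pi
import Mathlib.Combinatorics.SimpleGraph.Hasse
import Mathlib.Data.Real.Basic
import Mathlib.Logic.Function.Basic
import Mathlib.Tactic.Linarith
import Mathlib.Tactic.Positivity
import Mathlib.Tactic.FieldSimp
import Mathlib.Tactic.Ring
import HarnessLib

/-!
# Random quantum circuits: the collision-probability trajectory sum, its general lower bound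
# (Dalzell–Hunter-Jones–Brandão 2022, Theorem 4) and the upper bound for connected diagrams (Theorem 7),
# with the 1D architecture as the worked case

Topic `Literature/Computability/QuantumComplexity` (pub-qadeq lane, CLAIMS §5: the hardness language
of the random-circuit-sampling rows E-01…E-10 — “random circuits anticoncentrate at log depth” — and
the companion files `DesignAnticoncentration.lean` (what anticoncentration buys, and the collision
probability `Z = Σₓ p(x)²` of Definition 3 of this source) and `XEBSampleComplexity.lean`
(Barak–Chou–Gao's light-cone spoofer, whose runtime is governed by `2ⁿ Z` and whose 2D
`O(√log n)`-depth conjecture this source's Theorem 4 refutes)).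

HONEST FRAMING: instance-level adjudication of specific advantage claims; no claim about BQP vs BPP
or the summit.  This file is pure combinatorics of a weighted walk on `{I,S}ⁿ`; it asserts nothing
about any device or circuit family beyond what is printed, and it does NOT perform the Haar
average that identifies the walk with actual random circuits (see “Not formalised”).

## The source's framework [cite: DalzellHunterJonesBrandao2022, App. A “Framework for analysis: random quantum circuits as a stochastic process”]

A random quantum circuit (RQC) architecture on `n` qudits of local dimension `q` is a circuit
diagram — a sequence `A = (A⁽¹⁾, …, A⁽ˢ⁾)` of qudit pairs — on which Haar-random two-qudit gates are
applied after Haar-random single-qudit gates.  Averaging each gate over the Haar measure (or any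
exact 2-design) turns the expected collision probability
`Z = E_U[Σₓ p_U(x)²] = qⁿ E_U[p_U(1ⁿ)²]` into a finite sum (their eq. “Z = (q+1)⁻ⁿ Σ_γ weight(γ)”):
configurations are `γ⃗ ∈ {I,S}ⁿ`, a trajectory is a sequence `(γ⃗⁽⁰⁾,…,γ⃗⁽ˢ⁾)`, and the weight is
the product of the transfer elements

  `M⁽ᵗ⁾_{ν⃗γ⃗} = 1` if `γ_a = γ_b` and `ν⃗ = γ⃗`; `= q/(q²+1)` if `γ_a ≠ γ_b`, `ν_a = ν_b` and
  `ν_c = γ_c ∀ c ∉ {a,b}`; `= 0` otherwise (`A⁽ᵗ⁾ = {a,b}`).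

Equivalently (their §“Biased random walk”) `Z = q⁻ⁿ E_{P_b,Λ_b}[q^{|γ⃗⁽ˢ⁾|}]` for the Markov chain
that starts from `Λ_b(ν⃗) = qⁿ(q+1)⁻ⁿ q^{−|ν⃗|}` and, when the two sites of a gate disagree, flips
the `S` to `I` with probability `q²/(q²+1)` and the `I` to `S` with probability `1/(q²+1)`.

## Contents (all proved, 0 named facts)

* `Config n = Fin n → Bool` (`true = S`), `weight` (`|γ⃗|`, number of `S`), `Gate n = Fin n × Fin n`,
  `transfer q g ν γ` (the displayed `M⁽ᵗ⁾_{ν⃗γ⃗}`), `step`/`evolve` (apply the gates of a list in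
  order to a weight vector), **`collisionZ q A = (q+1)⁻ⁿ Σ_{ν⃗} (evolve A 𝟙)(ν⃗)`** — the
  trajectory sum, TAKEN AS THE DEFINITION of the architecture's expected collision probability.
* `sum_transfer` (column sums `1` or `2q/(q²+1)`), `collisionZ_nil` (`Z⁽⁰⁾ = 2ⁿ/(q+1)ⁿ`, the
  value “`Z⁽⁰⁾ = 2ⁿ/(q+1)ⁿ`” used in the proof of their Theorem 7), `collisionZ_append_le`
  (a gate never increases `Z`), `collisionZ_pos`.
* The biased walk: `biasedInit` (`Λ_b(ν⃗) = qⁿ(q+1)⁻ⁿq^{−|ν⃗|}` as printed; `biasedInit_eq_prod`: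
  it is the product law with site marginal `siteLaw`, `S` w.p. `1/(q+1)`), `btransfer`
  (`P_b = q^{|γ⃗|−|ν⃗|} M_{ν⃗γ⃗}`, with `btransfer_flipAt` giving the printed `q²/(q²+1)` for an
  `S → I` flip and `1/(q²+1)` for `I → S`), `sum_btransfer` (a stochastic kernel), `bdist` (the law
  of `γ⃗⁽ˢ⁾`; `sum_bdist`, `bdist_nonneg`), `bdist_eq` (the change of measure
  `bdist = qⁿ(q+1)⁻ⁿ q^{−|ν⃗|} · evolve 𝟙`) and **`collisionZ_eq_biased`**:
  `Z = q⁻ⁿ Σ_{ν⃗} bdist(ν⃗) q^{|ν⃗|}`.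
* The proof of Theorem 4 as printed: `siteMarginal` (`Pr_b[γ_j⁽ˢ⁾ = S]`), `siteMarginal_nil`
  (`= 1/(q+1)`), `le_sum_filter_btransfer` / `siteMarginal_append_ge` (a gate acting on `j` costs
  at most a factor `1/(q²+1)`, any other gate nothing), **`siteMarginal_ge`**
  (`≥ (q+1)⁻¹ (q²+1)^{−s_j}`, `s_j = touchCount A j` = number of gates on site `j`),
  `sum_bdist_weight_eq` (`E_b|γ⃗⁽ˢ⁾| = Σ_j Pr_b[γ_j⁽ˢ⁾ = S]`), `sum_touchCount_le` (`Σ_j s_j ≤ 2s`),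
  the two Jensen steps `rpow_sum_weight_le` (`q^{E|γ⃗|} ≤ E q^{|γ⃗|}`) and `rpow_avg_le_avg_rpow`
  (`c^{Σ s_j/n} ≤ (1/n)Σ c^{s_j}`), `expected_weight_ge` (`E|γ⃗⁽ˢ⁾| ≥ (n/(q+1))(q²+1)^{−2s/n}`), and
  **`collisionZ_ge`**: `Z ≥ q⁻ⁿ · q^{(n/(q+1)) (q²+1)^{−2s/n}}`, with the printed form
  **`collisionZ_ge_haar`**: `Z ≥ (Z_H/2) exp((log q/(q+1)) exp(log n − (2s/n) log(q²+1)))`,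
  `Z_H = 2/(qⁿ+1)` (`haarZ`) [cite: DalzellHunterJonesBrandao2022, Theorem 4 (= Theorem 8 of App. B §“Lower bound on collision probability”)].
* `log_le_of_collisionZ_le` — Corollary 3 in exact finite form: if `Z ≤ 2 Z_H` then
  `log n − log((q+1) log 4 / log q) ≤ (2s/n) log(q²+1)`, i.e.
  `s ≥ (2 log(q²+1))⁻¹ n log n − O(n)` with the `O(n)` explicit
  [cite: DalzellHunterJonesBrandao2022, Corollary 3 (App. B)]; Corollary 4 (`d ≥ 2s/n`) is the
  arithmetic remark that a layer holds at most `n/2` gates and is not restated.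
* Section `UpperBound` (v2) — Theorem 7's two ingredients and its deterministic form:
  `evolveFrom` (single-start bundles; linearity), `Crosses` / `Connecting` (the event of
  Definition 5 for the `S`-set of a configuration / for every proper subset),
  **`sum_evolveFrom_le_of_crosses`** (a crossing window costs a factor `2q/(q²+1)`),
  `sum_evolve_connecting_le`; the harmonic function `absorbS` (`P_S(x) = (q^{2x}−1)/(q^{2n}−1)`,
  Corollary 2; `absorbS_eq_printed`), **`sum_btransfer_absorbS`** (harmonicity under `P_b`),
  **`sum_bdist_absorbS`** (`E_b[P_S(|γ⃗⁽ᵗ⁾|)] = 1/(qⁿ+1)` at EVERY finite time — the optional-stopping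
  content of App. A §“Sanity check”), **`fixed_weight_le_haarZ`** (the weight sitting at `Iⁿ`, `Sⁿ`
  never exceeds `Z_H`), `collisionZ_append_connecting_le` (`Z(A ++ W) − Z_H ≤ (2q/(q²+1))(Z(A) − Z_H)`
  for a connecting window `W`), **`collisionZ_flatten_le`** / **`collisionZ_flatten_le_haar`**
  (`m` connecting windows: `Z ≤ Z_H + (2q/(q²+1))^m (2/(q+1))ⁿ ≤ Z_H(1 + (2q/(q+1))ⁿ(2q/(q²+1))^m)`)
  [cite: DalzellHunterJonesBrandao2022, Theorem 7 (App. B §“Upper bound on collision probability”) — Definition 5 specialised to windows that cross every partition WITH CERTAINTY (as in 1D: “it only takes two layers, or n gates”), for which the printed factor 1/2 + (1/2)(2q/(q²+1)) becomes 2q/(q²+1)].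
* Section `ConnectedWindows` (v3) — which windows cross every partition, and Theorem 7 for the 1D
  architecture: `couplingGraph W` (sites joined by a gate of `W`), **`connecting_of_preconnected`**
  (a window whose coupling graph is connected is `Connecting`), `collisionZ_replicate_le` (`d`
  repetitions of a connecting window: `Z ≤ Z_H(1 + (2q/(q+1))ⁿ(2q/(q²+1))ᵈ)`), `twoLayers` /
  `connecting_twoLayers` (two layers containing every bond `(i, i+1)` cross every partition — “In 1D,
  it only takes two layers, or n gates”), `ringBonds` / **`ringWindow`** (Definition 2's pair of
  layers on a ring, 0-indexed), `connecting_ringWindow`, **`collisionZ_ring_le`** (Theorem 7 for the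
  1D architecture in deterministic form: after `2d` layers `Z ≤ Z_H(1 + (2q/(q+1))ⁿ(2q/(q²+1))ᵈ)`, a
  linear-depth guarantee — NOT Theorem 1's `log n`), and the open-boundary variant `chainBonds` /
  `brickworkWindow` / `connecting_brickworkWindow` / `collisionZ_brickwork_le`
  [cite: DalzellHunterJonesBrandao2022, §7 Definition 2; App. B Definition 5, the remark after it, and Theorem 7].
* Section `Checks` (v4): `collisionZ_single_gate_two` (one gate on two qudits gives exactly
  `Z_H = 2/(q²+1)` — the transfer rule reproduces the Haar value), `two_pow_mul_collisionZ_ge`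
  (Theorem 4 at `q = 2`: `2ⁿZ ≥ 2^{(n/3)·5^{−2s/n}}`, the form used against Barak–Chou–Gao's 2D
  conjecture), `collisionZ_flatten_le_haar_of_preconnected` (Theorem 7's deterministic form for
  windows with connected coupling graphs) [cite: DalzellHunterJonesBrandao2022, §2 eq. (Z_H); §4; Theorem 7].

Throughout `q` is a real number: `q > 0` for the identities, `q ≥ 1` for Theorem 4 (its Jensen
steps use that `x ↦ qˣ` is increasing) and `q > 1` for Corollary 3 (the source has an integer local
dimension `q ≥ 2`; nothing below uses integrality), and the circuit diagram is any `List (Gate n)`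
(a “gate” `(a,a)` acts as the identity, consistently with the displayed rule, and only weakens the
per-site count `s_j`; the bound stays valid).

## Not formalised

The Haar / 2-design averaging of App. A §“Averaging individual unitaries over the Haar measure”
(Schur–Weyl: `M[σ] = αI + βS`) that DERIVES the trajectory sum from `E_U[Σₓ p_U(x)²]`; the unbiased
walk; Lemma 1 / Corollary 1 as statements about the INFINITE walk (only the harmonicity of `P_S` and
its finite-time consequence are proved) and the `s → ∞` limit `Z → Z_H` itself; Theorem 7 for
RANDOMISED architectures (Definition 5 with probability `1/2`, e.g. the complete-graph architecture);
Theorems 1–2, 5–6, 9–12 (the 1D / complete-graph bounds with their sharp constants — the “log depth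
suffices” headline needs the domain-wall analysis of App. C; for 1D only the linear-depth consequence of
Theorem 7 is here); Conjecture 1.  Nothing here says that
any finite experiment's circuits anticoncentrate.
-/

noncomputable section

namespace Literature.Computability.QuantumComplexity

namespace RandomCircuitCollision

open Finset Real

variable {n : ℕ}

/-! ## Configurations, gates and the transfer element -/

/-- A configuration `γ⃗ ∈ {I,S}ⁿ` of the Ising-like model: `true` = the swap `S`, `false` = the
identity `I`. [cite: DalzellHunterJonesBrandao2022, App. A §“Averaging individual unitaries over the Haar measure” (“We call each γ⃗ ∈ {I,S}ⁿ a configuration”)] -/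
abbrev Config (n : ℕ) := Fin n → Bool

/-- The Hamming weight `|γ⃗|` of a configuration: its number of `S` entries.
[cite: DalzellHunterJonesBrandao2022, App. A §“Biased random walk” (“|ν⃗| is the Hamming weight of ν⃗ (number of S entries)”)] -/
def weight (γ : Config n) : ℕ := (univ.filter fun j => γ j = true).card

/-- A two-qudit gate position `A⁽ᵗ⁾ = {a,b}`, recorded as an ordered pair; a circuit diagram is a
`List (Gate n)`. [cite: DalzellHunterJonesBrandao2022, §2 (“A RQC architecture is an instruction set on how to draw a circuit diagram”) and App. B (“Recall that an RQC architecture is a (possibly randomized) procedure for choosing a length-s sequence (A⁽¹⁾,…,A⁽ˢ⁾) of pairs of qudit indices on which to perform a Haar-random gate”)] -/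
abbrev Gate (n : ℕ) := Fin n × Fin n

/-- Site `j` is acted on by gate `g` (Boolean test; plumbing). [folklore] -/
def touches (g : Gate n) (j : Fin n) : Bool := decide (j = g.1) || decide (j = g.2)

/-- `touches g j ↔ j ∈ {a,b}` (plumbing). [folklore] -/
private theorem touches_iff {g : Gate n} {j : Fin n} : touches g j = true ↔ j = g.1 ∨ j = g.2 := by
  simp [touches]

/-- `s_j`: the number of gates of the diagram that act on site `j`.
[cite: DalzellHunterJonesBrandao2022, App. B proof of Theorem 8 (“the number of gates s_j that act on qudit j”)] -/
def touchCount (A : List (Gate n)) (j : Fin n) : ℕ := (A.filter fun g => touches g j).length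

/-- The transfer element `M⁽ᵗ⁾_{ν⃗γ⃗}` of a gate on `{a,b}`: `1` if `γ_a = γ_b` and `ν⃗ = γ⃗`;
`q/(q²+1)` if `γ_a ≠ γ_b`, `ν_a = ν_b` and `ν⃗`, `γ⃗` agree off `{a,b}`; `0` otherwise.
[cite: DalzellHunterJonesBrandao2022, App. A §“Averaging individual unitaries over the Haar measure” (display for M⁽ᵗ⁾_{ν⃗γ⃗})] -/
def transfer (q : ℝ) (g : Gate n) (ν γ : Config n) : ℝ :=
  if γ g.1 = γ g.2 then (if ν = γ then 1 else 0)
  else if ν g.1 = ν g.2 ∧ (∀ c, c ≠ g.1 → c ≠ g.2 → ν c = γ c) then q / (q ^ 2 + 1) else 0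

/-- One gate applied to a weight vector: `(T v)(ν⃗) = Σ_γ⃗ M_{ν⃗γ⃗} v(γ⃗)`. [folklore] -/
def step (q : ℝ) (g : Gate n) (v : Config n → ℝ) : Config n → ℝ :=
  fun ν => ∑ γ, transfer q g ν γ * v γ

/-- The gates of a diagram applied in order (`A⁽¹⁾` first). [folklore] -/
def evolve (q : ℝ) (A : List (Gate n)) (v : Config n → ℝ) : Config n → ℝ :=
  A.foldl (fun w g => step q g w) v

/-- **The collision probability of an architecture as a trajectory sum**:
`Z = (q+1)⁻ⁿ Σ_{trajectories} Π_t M⁽ᵗ⁾_{γ⃗⁽ᵗ⁾γ⃗⁽ᵗ⁻¹⁾} = (q+1)⁻ⁿ Σ_ν⃗ (T_s ⋯ T_1 𝟙)(ν⃗)`.  In the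
source this is DERIVED from `Z = qⁿ E_U[p_U(1ⁿ)²]` for Haar-random local gates; here it is the
definition. [cite: DalzellHunterJonesBrandao2022, App. A eq. “Z = (q+1)⁻ⁿ Σ_γ Π_t M⁽ᵗ⁾ =: (q+1)⁻ⁿ Σ_γ weight(γ)” (= main-text eq. quoted there)] -/
def collisionZ (q : ℝ) (A : List (Gate n)) : ℝ :=
  (∑ ν, evolve q A (fun _ => 1) ν) / (q + 1) ^ n

/-- The Haar value `Z_H = 2/(qⁿ+1)` of the collision probability.
[cite: DalzellHunterJonesBrandao2022, §2 (“Z_H = 2/(qⁿ+1)”) and App. A §“Sanity check: infinite circuit size convergence to Haar value”] -/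
def haarZ (q : ℝ) (n : ℕ) : ℝ := 2 / (q ^ n + 1)

/-- No gate: the weight vector is unchanged (plumbing). [folklore] -/
@[simp] private theorem evolve_nil (q : ℝ) (v : Config n → ℝ) : evolve q [] v = v := rfl

/-- Appending a gate applies one more `step` (plumbing). [folklore] -/
private theorem evolve_append (q : ℝ) (A : List (Gate n)) (g : Gate n) (v : Config n → ℝ) :
    evolve q (A ++ [g]) v = step q g (evolve q A v) := by
  simp [evolve, List.foldl_append]

/-! ## The configuration obtained by flipping one site -/

/-- `γ⃗` with site `k` flipped. [folklore] -/
def flipAt (γ : Config n) (k : Fin n) : Config n := Function.update γ k (!γ k)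

/-- The flipped site carries the negated value (plumbing). [folklore] -/
@[simp] private theorem flipAt_apply_self (γ : Config n) (k : Fin n) : flipAt γ k k = !γ k := by
  simp [flipAt]

/-- Other sites are unchanged by `flipAt` (plumbing). [folklore] -/
private theorem flipAt_apply_ne (γ : Config n) {k c : Fin n} (h : c ≠ k) : flipAt γ k c = γ c := by
  simp [flipAt, h]

/-- A flip changes the configuration (plumbing). [folklore] -/
private theorem flipAt_ne_self (γ : Config n) (k : Fin n) : flipAt γ k ≠ γ := by
  intro h
  have := congrFun h k
  simp at this

/-- Flipping an `S` lowers the Hamming weight by one, flipping an `I` raises it by one (plumbing). [folklore] -/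
private theorem weight_flipAt (γ : Config n) (k : Fin n) :
    weight (flipAt γ k) = if γ k = true then weight γ - 1 else weight γ + 1 := by
  classical
  unfold weight
  have hsplit : ∀ δ : Config n, (univ.filter fun j => δ j = true) =
      (if δ k = true then {k} else ∅) ∪ ((univ.erase k).filter fun j => δ j = true) := by
    intro δ
    ext j
    by_cases hj : j = k
    · subst hj; by_cases hδ : δ j = true <;> simp [hδ]
    · by_cases hδ : δ j = true <;> simp [hδ, hj]
      split_ifs <;> simp [hj]
  have hrest : ((univ.erase k).filter fun j => flipAt γ k j = true) =
      ((univ.erase k).filter fun j => γ j = true) := by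
    apply filter_congr
    intro j hj
    rw [flipAt_apply_ne γ (ne_of_mem_erase hj)]
  have hdisj : ∀ δ : Config n, Disjoint (if δ k = true then ({k} : Finset (Fin n)) else ∅)
      ((univ.erase k).filter fun j => δ j = true) := by
    intro δ
    split_ifs
    · simp
    · simp
  rw [hsplit (flipAt γ k), hsplit γ, card_union_of_disjoint (hdisj _),
    card_union_of_disjoint (hdisj _), hrest, flipAt_apply_self]
  by_cases hk : γ k = true
  · simp [hk]
  · simp [hk, add_comm]

/-! ## The transfer element: support, nonnegativity, column sums -/

/-- The transfer element is nonnegative (“Importantly, M⁽ᵗ⁾_{ν⃗γ⃗} is always non-negative”;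
plumbing form). [folklore] -/
private theorem transfer_nonneg {q : ℝ} (hq : 0 ≤ q) (g : Gate n) (ν γ : Config n) :
    0 ≤ transfer q g ν γ := by
  unfold transfer
  split_ifs <;> positivity

/-- Agreeing sites: the transfer element is the identity (plumbing form of the first case of the display). [folklore] -/
private theorem transfer_of_eq {q : ℝ} {g : Gate n} {γ : Config n} (h : γ g.1 = γ g.2) (ν : Config n) :
    transfer q g ν γ = if ν = γ then 1 else 0 := by
  simp [transfer, h]

/-- When the two sites of the gate disagree, the transfer element is supported on the two single
flips `flipAt γ a`, `flipAt γ b`, each with value `q/(q²+1)` (“one of them must be flipped so that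
the two output values agree”). [cite: DalzellHunterJonesBrandao2022, App. A §“Averaging individual unitaries over the Haar measure” (the three remarks after the display for M⁽ᵗ⁾_{ν⃗γ⃗})] -/
theorem transfer_of_ne {q : ℝ} {g : Gate n} {γ : Config n} (h : γ g.1 ≠ γ g.2) (ν : Config n) :
    transfer q g ν γ =
      if ν = flipAt γ g.1 ∨ ν = flipAt γ g.2 then q / (q ^ 2 + 1) else 0 := by
  have hab : g.1 ≠ g.2 := fun e => h (by rw [e])
  unfold transfer
  rw [if_neg h]
  congr 1
  apply propext
  constructor
  · rintro ⟨hνab, hoff⟩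
    -- `ν` agrees with `γ` off `{a,b}` and `ν_a = ν_b`; since `γ_a ≠ γ_b`, exactly one of them moved
    by_cases hνa : ν g.1 = γ g.1
    · right
      funext c
      by_cases hc2 : c = g.2
      · subst hc2
        rw [flipAt_apply_self]
        rw [← hνab, hνa]
        cases h1 : γ g.1 <;> cases h2 : γ g.2 <;> simp_all
      · rw [flipAt_apply_ne γ hc2]
        by_cases hc1 : c = g.1
        · subst hc1; exact hνa
        · exact hoff c hc1 hc2
    · left
      funext c
      by_cases hc1 : c = g.1
      · subst hc1
        rw [flipAt_apply_self]
        cases h1 : γ g.1 <;> cases h2 : ν g.1 <;> simp_all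
      · rw [flipAt_apply_ne γ hc1]
        by_cases hc2 : c = g.2
        · subst hc2
          rw [← hνab]
          have hνa' : ν g.1 = !γ g.1 := by
            cases h1 : γ g.1 <;> cases h2 : ν g.1 <;> simp_all
          rw [hνa']
          cases h1 : γ g.1 <;> cases h2 : γ g.2 <;> simp_all
        · exact hoff c hc1 hc2
  · rintro (rfl | rfl)
    · refine ⟨?_, fun c hc1 hc2 => flipAt_apply_ne γ hc1⟩
      rw [flipAt_apply_self, flipAt_apply_ne γ hab.symm]
      cases h1 : γ g.1 <;> cases h2 : γ g.2 <;> simp_all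
    · refine ⟨?_, fun c hc1 hc2 => flipAt_apply_ne γ hc2⟩
      rw [flipAt_apply_self, flipAt_apply_ne γ hab]
      cases h1 : γ g.1 <;> cases h2 : γ g.2 <;> simp_all

/-- The two single flips of a disagreeing pair are distinct configurations (plumbing). [folklore] -/
private theorem flipAt_fst_ne_flipAt_snd {g : Gate n} {γ : Config n} (h : γ g.1 ≠ γ g.2) :
    flipAt γ g.1 ≠ flipAt γ g.2 := by
  have hab : g.1 ≠ g.2 := fun e => h (by rw [e])
  intro e
  have := congrFun e g.1
  rw [flipAt_apply_self, flipAt_apply_ne γ hab] at this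
  cases h1 : γ g.1 <;> simp_all

/-- A sum over configurations of a function supported on the two flips. [folklore] -/
private theorem sum_ite_flip {g : Gate n} {γ : Config n} (h : γ g.1 ≠ γ g.2) (f : Config n → ℝ) :
    ∑ ν, (if ν = flipAt γ g.1 ∨ ν = flipAt γ g.2 then f ν else 0) =
      f (flipAt γ g.1) + f (flipAt γ g.2) := by
  classical
  have hne := flipAt_fst_ne_flipAt_snd h
  rw [← sum_filter]
  have hS : (univ.filter fun ν : Config n => ν = flipAt γ g.1 ∨ ν = flipAt γ g.2) =
      {flipAt γ g.1, flipAt γ g.2} := by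
    ext ν; simp
  rw [hS, sum_pair hne]

/-- Column sums of the transfer element: `Σ_ν⃗ M_{ν⃗γ⃗} = 1` if `γ_a = γ_b`, and `2q/(q²+1)` (the
weight lost at a bit flip of the unbiased walk) otherwise.
[cite: DalzellHunterJonesBrandao2022, App. A §“Unbiased random walk” (“the weight is reduced each time a bit is flipped … (2q/(q²+1))^{# of bit flips}”)] -/
theorem sum_transfer (q : ℝ) (g : Gate n) (γ : Config n) :
    ∑ ν, transfer q g ν γ = if γ g.1 = γ g.2 then 1 else 2 * q / (q ^ 2 + 1) := by
  classical
  by_cases h : γ g.1 = γ g.2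
  · simp only [transfer_of_eq h, if_pos h]
    simp
  · simp only [transfer_of_ne h, if_neg h]
    rw [sum_ite_flip h]
    ring

/-- `2q/(q²+1) ≤ 1` (AM–GM; plumbing). [folklore] -/
private theorem two_mul_div_sq_add_one_le_one (q : ℝ) : 2 * q / (q ^ 2 + 1) ≤ 1 := by
  rw [div_le_one (by positivity)]
  nlinarith [sq_nonneg (q - 1)]

/-- Every column sum of the transfer element is at most one (plumbing). [folklore] -/
private theorem sum_transfer_le_one {q : ℝ} (g : Gate n) (γ : Config n) :
    ∑ ν, transfer q g ν γ ≤ 1 := by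
  rw [sum_transfer]
  split_ifs
  · exact le_rfl
  · exact two_mul_div_sq_add_one_le_one q

/-! ## `Z⁽⁰⁾`, positivity, monotonicity -/

/-- Evolving a nonnegative weight vector keeps it nonnegative (plumbing). [folklore] -/
private theorem evolve_nonneg {q : ℝ} (hq : 0 ≤ q) :
    ∀ (A : List (Gate n)) (v : Config n → ℝ), (∀ γ, 0 ≤ v γ) → ∀ ν, 0 ≤ evolve q A v ν := by
  intro A
  induction A using List.reverseRecOn with
  | nil => intro v hv ν; simpa using hv ν
  | append_singleton A g ih =>
      intro v hv ν
      rw [evolve_append]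
      exact sum_nonneg fun γ _ => mul_nonneg (transfer_nonneg hq g ν γ) (ih v hv γ)

/-- Applying a gate cannot increase the total weight. [folklore] -/
private theorem sum_step_le (q : ℝ) (g : Gate n) {v : Config n → ℝ} (hv : ∀ γ, 0 ≤ v γ) :
    ∑ ν, step q g v ν ≤ ∑ γ, v γ := by
  unfold step
  rw [sum_comm]
  refine sum_le_sum fun γ _ => ?_
  rw [← sum_mul]
  calc (∑ ν, transfer q g ν γ) * v γ ≤ 1 * v γ :=
        mul_le_mul_of_nonneg_right (sum_transfer_le_one g γ) (hv γ)
    _ = v γ := one_mul _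

/-- **`Z⁽⁰⁾ = 2ⁿ/(q+1)ⁿ`**: with no two-qudit gate every configuration has weight one.
[cite: DalzellHunterJonesBrandao2022, App. B proof of Theorem 7 (“Z⁽⁰⁾ = 2ⁿ/(q+1)ⁿ”)] -/
theorem collisionZ_nil (q : ℝ) : collisionZ q ([] : List (Gate n)) = (2 / (q + 1)) ^ n := by
  unfold collisionZ
  simp only [evolve_nil, sum_const, card_univ, Fintype.card_fun, Fintype.card_bool,
    Fintype.card_fin, nsmul_eq_mul, mul_one]
  rw [div_pow]
  push_cast
  ring

/-- **A gate never increases `Z`** (every column sum of `M⁽ᵗ⁾` is at most one).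
[cite: DalzellHunterJonesBrandao2022, App. A §“Unbiased random walk” and App. B proof of Theorem 7 (“the weight of that trajectory is reduced by factor 2q/(q²+1)”)] -/
theorem collisionZ_append_le {q : ℝ} (hq : 0 ≤ q) (A : List (Gate n)) (g : Gate n) :
    collisionZ q (A ++ [g]) ≤ collisionZ q A := by
  unfold collisionZ
  refine div_le_div_of_nonneg_right ?_ (by positivity)
  simp only [evolve_append]
  exact sum_step_le q g (evolve_nonneg hq A _ (fun _ => zero_le_one))

/-- `Z ≤ Z⁽⁰⁾ = 2ⁿ/(q+1)ⁿ` for every circuit diagram.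
[cite: DalzellHunterJonesBrandao2022, App. B proof of Theorem 7 (“Z⁽⁰⁾ = 2ⁿ/(q+1)ⁿ” with the weight reductions)] -/
theorem collisionZ_le_nil {q : ℝ} (hq : 0 ≤ q) :
    ∀ A : List (Gate n), collisionZ q A ≤ (2 / (q + 1)) ^ n := by
  intro A
  induction A using List.reverseRecOn with
  | nil => rw [collisionZ_nil]
  | append_singleton A g ih => exact (collisionZ_append_le hq A g).trans ih


/-- `Z > 0`: the all-`I` trajectory keeps weight one and all weights are nonnegative (“Importantly, M⁽ᵗ⁾_{ν⃗γ⃗} is always non-negative”).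
[cite: DalzellHunterJonesBrandao2022, App. A §“Averaging individual unitaries over the Haar measure”] -/
theorem collisionZ_pos {q : ℝ} (hq : 0 ≤ q) (A : List (Gate n)) : 0 < collisionZ q A := by
  -- the all-`I` trajectory keeps weight one
  unfold collisionZ
  refine div_pos ?_ (by positivity)
  have hI : ∀ B : List (Gate n), 1 ≤ evolve q B (fun _ => 1) (fun _ => false) := by
    intro B
    induction B using List.reverseRecOn with
    | nil => simp
    | append_singleton B g ih =>
        rw [evolve_append]
        unfold step
        have hγ : (fun _ : Fin n => false) g.1 = (fun _ : Fin n => false) g.2 := rfl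
        calc (1 : ℝ) ≤ transfer q g (fun _ => false) (fun _ => false) *
              evolve q B (fun _ => 1) (fun _ => false) := by
              rw [transfer_of_eq hγ, if_pos rfl, one_mul]; exact ih
          _ ≤ ∑ γ, transfer q g (fun _ => false) γ * evolve q B (fun _ => 1) γ :=
              single_le_sum (f := fun γ => transfer q g (fun _ => false) γ *
                evolve q B (fun _ => 1) γ)
                (fun γ _ => mul_nonneg (transfer_nonneg hq g _ γ)
                  (evolve_nonneg hq B _ (fun _ => zero_le_one) γ)) (mem_univ _)
  calc (0 : ℝ) < 1 := one_pos
    _ ≤ evolve q A (fun _ => 1) (fun _ => false) := hI A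
    _ ≤ ∑ ν, evolve q A (fun _ => 1) ν :=
        single_le_sum (f := fun ν => evolve q A (fun _ => 1) ν)
          (fun ν _ => evolve_nonneg hq A _ (fun _ => zero_le_one) ν) (mem_univ _)

/-! ## The biased random walk `(Λ_b, P_b)` and the change of measure -/

/-- The initial law `Λ_b(ν⃗) = qⁿ (q+1)⁻ⁿ q^{−|ν⃗|}` of the biased walk.
[cite: DalzellHunterJonesBrandao2022, App. A §“Biased random walk” (display for Λ_b)] -/
def biasedInit (q : ℝ) (ν : Config n) : ℝ := (q / (q + 1)) ^ n / q ^ weight ν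

/-- The site law behind `Λ_b`: `S` with probability `1/(q+1)`, `I` with probability `q/(q+1)`.
[folklore] -/
def siteLaw (q : ℝ) (b : Bool) : ℝ := if b = true then 1 / (q + 1) else q / (q + 1)

/-- The site law is nonnegative (plumbing). [folklore] -/
private theorem siteLaw_nonneg {q : ℝ} (hq : 0 ≤ q) (b : Bool) : 0 ≤ siteLaw q b := by
  unfold siteLaw; split_ifs <;> positivity

/-- The site law is a probability vector (plumbing). [folklore] -/
private theorem sum_siteLaw {q : ℝ} (hq : 0 ≤ q) : ∑ b, siteLaw q b = 1 := by
  have h1 : (q + 1) ≠ 0 := by positivity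
  simp only [Fintype.sum_bool, siteLaw, if_true, Bool.false_eq_true, if_false]
  field_simp
  ring

/-- The number of `I` entries is `n − |ν⃗|` (plumbing). [folklore] -/
private theorem card_filter_not_eq_sub_weight (ν : Config n) :
    (univ.filter fun j => ¬ ν j = true).card = n - weight ν := by
  have h := Finset.card_filter_add_card_filter_not (s := (univ : Finset (Fin n)))
    (p := fun j => ν j = true)
  simp only [card_univ, Fintype.card_fin] at h
  unfold weight
  omega

/-- `|ν⃗| ≤ n` (plumbing). [folklore] -/
private theorem weight_le (ν : Config n) : weight ν ≤ n := by
  unfold weight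
  exact (card_filter_le _ _).trans (by simp)

/-- `Λ_b` is the product law with site marginal `siteLaw`. [folklore] -/
private theorem biasedInit_eq_prod {q : ℝ} (hq : 0 < q) (ν : Config n) :
    biasedInit q ν = ∏ j, siteLaw q (ν j) := by
  classical
  unfold biasedInit siteLaw
  rw [prod_ite, prod_const, prod_const, card_filter_not_eq_sub_weight]
  change _ = (1 / (q + 1)) ^ weight ν * (q / (q + 1)) ^ (n - weight ν)
  have hw := weight_le ν
  have hq1 : q + 1 ≠ 0 := by positivity
  have hq0 : q ≠ 0 := hq.ne'
  rw [div_pow, div_pow, div_pow, one_pow]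
  rw [show (q + 1) ^ n = (q + 1) ^ weight ν * (q + 1) ^ (n - weight ν) by
    rw [← pow_add, Nat.add_sub_cancel' hw]]
  rw [show q ^ n = q ^ weight ν * q ^ (n - weight ν) by
    rw [← pow_add, Nat.add_sub_cancel' hw]]
  field_simp

/-- `Λ_b > 0` pointwise (plumbing). [folklore] -/
private theorem biasedInit_pos {q : ℝ} (hq : 0 < q) (ν : Config n) : 0 < biasedInit q ν := by
  unfold biasedInit; positivity

/-- Sums over `{I,S}ⁿ` of site products factor. [folklore] -/
private theorem sum_prod_site (f : Fin n → Bool → ℝ) :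
    ∑ ν : Config n, ∏ j, f j (ν j) = ∏ j, ∑ b, f j b := by
  classical
  rw [prod_univ_sum, Fintype.piFinset_univ]

/-- `Λ_b` is a probability distribution on `{I,S}ⁿ`.
[cite: DalzellHunterJonesBrandao2022, App. A §“Biased random walk” (Λ_b is “the initial distribution”)] -/
theorem sum_biasedInit {q : ℝ} (hq : 0 < q) : ∑ ν : Config n, biasedInit q ν = 1 := by
  simp only [biasedInit_eq_prod hq]
  rw [sum_prod_site]
  simp only [sum_siteLaw hq.le, prod_const_one]

/-- The biased transition kernel `P_b(ν⃗ | γ⃗) = q^{|γ⃗|−|ν⃗|} M_{ν⃗γ⃗}`.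
[cite: DalzellHunterJonesBrandao2022, App. A §“Biased random walk” (“the dynamics of P_b are the same as P_u, except that … it chooses to flip the S to I with probability q²/(q²+1) and I to S with probability 1/(q²+1)”)] -/
def btransfer (q : ℝ) (g : Gate n) (ν γ : Config n) : ℝ :=
  transfer q g ν γ * q ^ weight γ / q ^ weight ν

/-- `P_b ≥ 0` (plumbing). [folklore] -/
private theorem btransfer_nonneg {q : ℝ} (hq : 0 ≤ q) (g : Gate n) (ν γ : Config n) :
    0 ≤ btransfer q g ν γ := by
  unfold btransfer
  exact div_nonneg (mul_nonneg (transfer_nonneg hq g ν γ) (pow_nonneg hq _)) (pow_nonneg hq _)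

/-- Agreeing sites: the biased kernel does not move (plumbing). [folklore] -/
private theorem btransfer_of_eq {q : ℝ} (hq : 0 < q) {g : Gate n} {γ : Config n} (h : γ g.1 = γ g.2)
    (ν : Config n) : btransfer q g ν γ = if ν = γ then 1 else 0 := by
  unfold btransfer
  rw [transfer_of_eq h]
  split_ifs with hν
  · subst hν; field_simp
  · simp

/-- A configuration with an `S` entry has positive Hamming weight (plumbing). [folklore] -/
private theorem one_le_weight_of_apply {γ : Config n} {k : Fin n} (hk : γ k = true) : 1 ≤ weight γ := by
  unfold weight
  exact card_pos.2 ⟨k, by simp [hk]⟩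

/-- The value of `P_b` on a single flip: `q²/(q²+1)` for `S → I`, `1/(q²+1)` for `I → S`.
[cite: DalzellHunterJonesBrandao2022, App. A §“Biased random walk”] -/
theorem btransfer_flipAt {q : ℝ} (hq : 0 < q) {g : Gate n} {γ : Config n} (h : γ g.1 ≠ γ g.2)
    {k : Fin n} (hk : k = g.1 ∨ k = g.2) :
    btransfer q g (flipAt γ k) γ =
      if γ k = true then q ^ 2 / (q ^ 2 + 1) else 1 / (q ^ 2 + 1) := by
  have hsupp : flipAt γ k = flipAt γ g.1 ∨ flipAt γ k = flipAt γ g.2 := by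
    rcases hk with rfl | rfl
    · exact Or.inl rfl
    · exact Or.inr rfl
  unfold btransfer
  rw [transfer_of_ne h, if_pos hsupp, weight_flipAt]
  have hq0 : q ≠ 0 := hq.ne'
  have hq2 : q ^ 2 + 1 ≠ 0 := by positivity
  by_cases hγk : γ k = true
  · rw [if_pos hγk, if_pos hγk]
    have hw := one_le_weight_of_apply hγk
    rw [show q ^ weight γ = q ^ (weight γ - 1) * q by
      rw [← pow_succ, Nat.sub_add_cancel hw]]
    field_simp
  · rw [if_neg hγk, if_neg hγk, pow_succ q (weight γ)]
    field_simp

/-- `P_b(· | γ⃗)` is a probability vector. [cite: DalzellHunterJonesBrandao2022, App. A §“Biased random walk”] -/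
theorem sum_btransfer {q : ℝ} (hq : 0 < q) (g : Gate n) (γ : Config n) :
    ∑ ν, btransfer q g ν γ = 1 := by
  classical
  by_cases h : γ g.1 = γ g.2
  · simp only [btransfer_of_eq hq h]
    simp
  · have hsupp : ∀ ν, btransfer q g ν γ =
        if ν = flipAt γ g.1 ∨ ν = flipAt γ g.2 then btransfer q g ν γ else 0 := by
      intro ν
      split_ifs with hν
      · rfl
      · unfold btransfer; rw [transfer_of_ne h, if_neg hν]; simp
    rw [sum_congr rfl fun ν _ => hsupp ν, sum_ite_flip h,
      btransfer_flipAt hq h (Or.inl rfl), btransfer_flipAt hq h (Or.inr rfl)]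
    have hq2 : q ^ 2 + 1 ≠ 0 := by positivity
    have e1 : q ^ 2 / (q ^ 2 + 1) + 1 / (q ^ 2 + 1) = 1 := by
      rw [← add_div, div_self hq2]
    have e2 : 1 / (q ^ 2 + 1) + q ^ 2 / (q ^ 2 + 1) = 1 := by
      rw [← add_div, add_comm, div_self hq2]
    cases h1 : γ g.1 <;> cases h2 : γ g.2 <;> simp_all

/-- One step of the biased walk on a law `d`. [folklore] -/
def bstep (q : ℝ) (g : Gate n) (d : Config n → ℝ) : Config n → ℝ :=
  fun ν => ∑ γ, btransfer q g ν γ * d γ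

/-- The law of `γ⃗⁽ˢ⁾` under the biased walk started from `Λ_b`. [cite: DalzellHunterJonesBrandao2022, App. A §“Biased random walk”] -/
def bdist (q : ℝ) (A : List (Gate n)) : Config n → ℝ :=
  A.foldl (fun d g => bstep q g d) (biasedInit q)

/-- No gate: the law is `Λ_b` (plumbing). [folklore] -/
@[simp] private theorem bdist_nil (q : ℝ) : bdist q ([] : List (Gate n)) = biasedInit q := rfl

/-- Appending a gate applies one more `bstep` (plumbing). [folklore] -/
private theorem bdist_append (q : ℝ) (A : List (Gate n)) (g : Gate n) :
    bdist q (A ++ [g]) = bstep q g (bdist q A) := by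
  simp [bdist, List.foldl_append]

/-- A biased step preserves total mass (plumbing). [folklore] -/
private theorem sum_bstep {q : ℝ} (hq : 0 < q) (g : Gate n) (d : Config n → ℝ) :
    ∑ ν, bstep q g d ν = ∑ γ, d γ := by
  unfold bstep
  rw [sum_comm]
  refine sum_congr rfl fun γ _ => ?_
  rw [← sum_mul, sum_btransfer hq, one_mul]

/-- The law of `γ⃗⁽ˢ⁾` under the biased walk is a probability distribution.
[cite: DalzellHunterJonesBrandao2022, App. A §“Biased random walk”] -/
theorem sum_bdist {q : ℝ} (hq : 0 < q) : ∀ A : List (Gate n), ∑ ν, bdist q A ν = 1 := by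
  intro A
  induction A using List.reverseRecOn with
  | nil => simpa using sum_biasedInit hq
  | append_singleton A g ih => rw [bdist_append, sum_bstep hq, ih]

/-- The law of `γ⃗⁽ˢ⁾` is nonnegative (plumbing). [folklore] -/
private theorem bdist_nonneg {q : ℝ} (hq : 0 < q) : ∀ (A : List (Gate n)) ν, 0 ≤ bdist q A ν := by
  intro A
  induction A using List.reverseRecOn with
  | nil => intro ν; exact (biasedInit_pos hq ν).le
  | append_singleton A g ih =>
      intro ν
      rw [bdist_append]
      exact sum_nonneg fun γ _ => mul_nonneg (btransfer_nonneg hq.le g ν γ) (ih γ)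

/-- **The change of measure** between the trajectory sum and the biased walk:
`Pr_b[γ⃗⁽ˢ⁾ = ν⃗] = qⁿ(q+1)⁻ⁿ q^{−|ν⃗|} · Σ_{trajectories ending at ν⃗} weight` (“once the probability
of observing a certain trajectory is included, every trajectory contributes the same amount to Z”).
[cite: DalzellHunterJonesBrandao2022, App. A §“Biased random walk”] -/
theorem bdist_eq {q : ℝ} (hq : 0 < q) :
    ∀ (A : List (Gate n)) ν, bdist q A ν = (q / (q + 1)) ^ n / q ^ weight ν *
      evolve q A (fun _ => 1) ν := by
  intro A
  induction A using List.reverseRecOn with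
  | nil => intro ν; simp [biasedInit]
  | append_singleton A g ih =>
      intro ν
      rw [bdist_append, evolve_append]
      unfold bstep step
      rw [mul_sum]
      refine sum_congr rfl fun γ _ => ?_
      rw [ih γ]
      unfold btransfer
      have hqw : q ^ weight γ ≠ 0 := pow_ne_zero _ hq.ne'
      have hqν : q ^ weight ν ≠ 0 := pow_ne_zero _ hq.ne'
      field_simp

/-- **`Z = q⁻ⁿ E_{P_b,Λ_b}[q^{|γ⃗⁽ˢ⁾|}]`.**
[cite: DalzellHunterJonesBrandao2022, App. A §“Biased random walk” (display “Z = q⁻ⁿ 𝔼_{P_b,Λ_b}[q^{|γ⃗⁽ˢ⁾|}]”)] -/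
theorem collisionZ_eq_biased {q : ℝ} (hq : 0 < q) (A : List (Gate n)) :
    collisionZ q A = (∑ ν, bdist q A ν * q ^ weight ν) / q ^ n := by
  unfold collisionZ
  have hq1 : (q + 1) ^ n ≠ 0 := by positivity
  have hqn : q ^ n ≠ 0 := by positivity
  rw [div_eq_div_iff hq1 hqn]
  rw [sum_mul, sum_mul]
  refine sum_congr rfl fun ν _ => ?_
  rw [bdist_eq hq A ν]
  have hqw : q ^ weight ν ≠ 0 := pow_ne_zero _ hq.ne'
  field_simp
  rw [div_pow]
  field_simp

/-! ## Site marginals `Pr_b[γ_j⁽ˢ⁾ = S]` and the per-site lower bound -/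

/-- `Pr_{P_b,Λ_b}[γ_j⁽ˢ⁾ = S]`. [cite: DalzellHunterJonesBrandao2022, App. B proof of Theorem 8] -/
def siteMarginal (q : ℝ) (A : List (Gate n)) (j : Fin n) : ℝ :=
  ∑ ν ∈ univ.filter (fun ν : Config n => ν j = true), bdist q A ν

/-- “there is a `1/(q+1)` chance that `γ_j⁽⁰⁾ = S` when we draw `γ⃗⁽⁰⁾` from `Λ_b`”.
[cite: DalzellHunterJonesBrandao2022, App. B proof of Theorem 8] -/
theorem siteMarginal_nil {q : ℝ} (hq : 0 < q) (j : Fin n) :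
    siteMarginal q ([] : List (Gate n)) j = 1 / (q + 1) := by
  classical
  unfold siteMarginal
  simp only [bdist_nil]
  -- insert the indicator of `{ν_j = S}` into the site product
  set f : Fin n → Bool → ℝ := fun i b => if i = j then (if b = true then siteLaw q b else 0)
    else siteLaw q b with hf
  have hprod : ∀ ν : Config n, (∏ i, f i (ν i)) =
      if ν j = true then ∏ i, siteLaw q (ν i) else 0 := by
    intro ν
    rw [← mul_prod_erase univ (fun i => f i (ν i)) (mem_univ j),
      ← mul_prod_erase univ (fun i => siteLaw q (ν i)) (mem_univ j)]
    have hrest : ∏ i ∈ univ.erase j, f i (ν i) = ∏ i ∈ univ.erase j, siteLaw q (ν i) :=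
      prod_congr rfl fun i hi => by rw [hf]; simp [ne_of_mem_erase hi]
    rw [hrest]
    by_cases hν : ν j = true
    · simp [hf, hν]
    · simp [hf, hν]
  rw [sum_filter]
  simp only [biasedInit_eq_prod hq, ← hprod]
  rw [sum_prod_site, ← mul_prod_erase univ (fun i => ∑ b, f i b) (mem_univ j)]
  have hrest : ∏ i ∈ univ.erase j, ∑ b, f i b = 1 := by
    refine prod_eq_one fun i hi => ?_
    rw [hf]; simp only [ne_of_mem_erase hi, if_false]; exact sum_siteLaw hq.le
  rw [hrest, mul_one, hf]
  simp [siteLaw]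

/-- For a configuration with `γ_j = S`, the biased kernel keeps site `j` at `S` with probability at
least `1/(q²+1)` if the gate acts on `j`, and with probability one otherwise (“the probability it
does not flip after each gate is at least `1/(q²+1)`”).
[cite: DalzellHunterJonesBrandao2022, App. B proof of Theorem 8] -/
theorem le_sum_filter_btransfer {q : ℝ} (hq : 0 < q) (g : Gate n) (j : Fin n) {γ : Config n}
    (hγ : γ j = true) :
    (if touches g j then 1 / (q ^ 2 + 1) else 1) ≤
      ∑ ν ∈ univ.filter (fun ν : Config n => ν j = true), btransfer q g ν γ := by
  classical
  have hc1 : (if touches g j then 1 / (q ^ 2 + 1) else (1 : ℝ)) ≤ 1 := by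
    split_ifs
    · rw [div_le_one (by positivity)]; nlinarith [sq_nonneg q]
    · exact le_rfl
  have hnn : ∀ ν ∈ univ.filter (fun ν : Config n => ν j = true), 0 ≤ btransfer q g ν γ :=
    fun ν _ => btransfer_nonneg hq.le g ν γ
  by_cases h : γ g.1 = γ g.2
  · -- the walk does not move: `P_b(γ | γ) = 1`
    calc (if touches g j then 1 / (q ^ 2 + 1) else (1 : ℝ)) ≤ 1 := hc1
      _ = btransfer q g γ γ := by rw [btransfer_of_eq hq h, if_pos rfl]
      _ ≤ _ := single_le_sum hnn (by simp [hγ])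
  · by_cases ht : touches g j
    · -- `j` is one of the two disagreeing sites and carries `S`; the other site carries `I`,
      -- and flipping it to `S` keeps `j` at `S` with probability `1/(q²+1)`
      rw [if_pos ht]
      obtain ⟨k, hk, hkj, hγk⟩ : ∃ k, (k = g.1 ∨ k = g.2) ∧ k ≠ j ∧ γ k = false := by
        rcases touches_iff.1 ht with rfl | rfl
        · refine ⟨g.2, Or.inr rfl, fun e => h (by rw [e]), ?_⟩
          cases h2 : γ g.2 <;> simp_all
        · refine ⟨g.1, Or.inl rfl, fun e => h (by rw [e]), ?_⟩
          cases h1 : γ g.1 <;> simp_all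
      calc 1 / (q ^ 2 + 1) = btransfer q g (flipAt γ k) γ := by
            rw [btransfer_flipAt hq h hk]; simp [hγk]
        _ ≤ _ := single_le_sum hnn (by
            simp only [mem_filter, mem_univ, true_and]
            rw [flipAt_apply_ne γ hkj.symm]; exact hγ)
    · -- the gate does not act on `j`: all of `P_b(· | γ)` stays in `{ν_j = S}`
      rw [if_neg ht]
      have hj1 : j ≠ g.1 := fun e => ht (touches_iff.2 (Or.inl e))
      have hj2 : j ≠ g.2 := fun e => ht (touches_iff.2 (Or.inr e))
      rw [sum_filter_of_ne, sum_btransfer hq]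
      intro ν _ hν
      have : ν = flipAt γ g.1 ∨ ν = flipAt γ g.2 := by
        by_contra hcon
        apply hν
        unfold btransfer; rw [transfer_of_ne h, if_neg hcon]; simp
      rcases this with rfl | rfl
      · rw [flipAt_apply_ne γ hj1]; exact hγ
      · rw [flipAt_apply_ne γ hj2]; exact hγ

/-- One gate: `Pr_b[γ_j⁽ᵗ⁺¹⁾ = S] ≥ (1/(q²+1))^{[gate acts on j]} · Pr_b[γ_j⁽ᵗ⁾ = S]`.
[cite: DalzellHunterJonesBrandao2022, App. B proof of Theorem 8] -/
theorem siteMarginal_append_ge {q : ℝ} (hq : 0 < q) (A : List (Gate n)) (g : Gate n)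
    (j : Fin n) :
    (if touches g j then 1 / (q ^ 2 + 1) else 1) * siteMarginal q A j ≤
      siteMarginal q (A ++ [g]) j := by
  classical
  set F := univ.filter (fun ν : Config n => ν j = true) with hF
  set c : ℝ := if touches g j then 1 / (q ^ 2 + 1) else 1 with hc
  have hc0 : 0 ≤ c := by rw [hc]; split_ifs <;> positivity
  unfold siteMarginal
  rw [bdist_append]
  unfold bstep
  -- exchange the sums: Σ_{ν ∈ F} Σ_γ P_b(ν|γ) d(γ) = Σ_γ d(γ) Σ_{ν ∈ F} P_b(ν|γ)
  rw [sum_comm]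
  calc c * ∑ γ ∈ F, bdist q A γ = ∑ γ ∈ F, c * bdist q A γ := by rw [mul_sum]
    _ ≤ ∑ γ ∈ F, (∑ ν ∈ F, btransfer q g ν γ) * bdist q A γ := by
        refine sum_le_sum fun γ hγ => mul_le_mul_of_nonneg_right ?_ (bdist_nonneg hq A γ)
        exact le_sum_filter_btransfer hq g j (mem_filter.1 hγ).2
    _ ≤ ∑ γ, (∑ ν ∈ F, btransfer q g ν γ) * bdist q A γ :=
        sum_le_sum_of_subset_of_nonneg (filter_subset _ _) fun γ _ _ =>
          mul_nonneg (sum_nonneg fun ν _ => btransfer_nonneg hq.le g ν γ) (bdist_nonneg hq A γ)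
    _ = ∑ γ, ∑ ν ∈ F, btransfer q g ν γ * bdist q A γ := by
        refine sum_congr rfl fun γ _ => ?_; rw [sum_mul]

/-- Appending a gate adds one to `s_j` exactly when it acts on `j` (plumbing). [folklore] -/
private theorem touchCount_append (A : List (Gate n)) (g : Gate n) (j : Fin n) :
    touchCount (A ++ [g]) j = touchCount A j + if touches g j then 1 else 0 := by
  unfold touchCount
  rw [List.filter_append, List.length_append]
  by_cases h : touches g j <;> simp [h]

/-- **Per-site bound**: `Pr_{P_b,Λ_b}[γ_j⁽ˢ⁾ = S] ≥ (q+1)⁻¹ (q²+1)^{−s_j}`.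
[cite: DalzellHunterJonesBrandao2022, App. B proof of Theorem 8 (display “Pr[γ_j⁽ᵗ⁾ = S ∀ t] ≥ (1/(q+1))(1/(q²+1))^{s_j}”)] -/
theorem siteMarginal_ge {q : ℝ} (hq : 0 < q) (j : Fin n) :
    ∀ A : List (Gate n),
      1 / (q + 1) * (1 / (q ^ 2 + 1)) ^ touchCount A j ≤ siteMarginal q A j := by
  intro A
  induction A using List.reverseRecOn with
  | nil => rw [siteMarginal_nil hq]; simp [touchCount]
  | append_singleton A g ih =>
      rw [touchCount_append]
      refine le_trans ?_ (siteMarginal_append_ge hq A g j)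
      by_cases h : touches g j
      · rw [if_pos h, if_pos h, pow_succ]
        have hc : 0 ≤ 1 / (q ^ 2 + 1) := by positivity
        calc 1 / (q + 1) * ((1 / (q ^ 2 + 1)) ^ touchCount A j * (1 / (q ^ 2 + 1)))
            = 1 / (q ^ 2 + 1) * (1 / (q + 1) * (1 / (q ^ 2 + 1)) ^ touchCount A j) := by ring
          _ ≤ 1 / (q ^ 2 + 1) * siteMarginal q A j := mul_le_mul_of_nonneg_left ih hc
      · rw [if_neg h, if_neg h, add_zero, one_mul]; exact ih

/-- `E_{P_b,Λ_b}[|γ⃗⁽ˢ⁾|] = Σ_j Pr_b[γ_j⁽ˢ⁾ = S]`. [cite: DalzellHunterJonesBrandao2022, App. B proof of Theorem 8 (first line of the display for 𝔼|γ⃗⁽ˢ⁾|)] -/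
theorem sum_bdist_weight_eq (q : ℝ) (A : List (Gate n)) :
    ∑ ν, bdist q A ν * (weight ν : ℝ) = ∑ j, siteMarginal q A j := by
  classical
  unfold siteMarginal weight
  simp only [card_eq_sum_ones, Nat.cast_sum, sum_filter, mul_sum]
  rw [sum_comm]
  refine sum_congr rfl fun j _ => sum_congr rfl fun ν _ => ?_
  split_ifs <;> simp

/-- `Σ_j s_j ≤ 2s` (“since each of the s gates in the circuit diagram acts on two indices, it must hold that Σ_j s_j = 2s”; with `≤` because a degenerate gate `(a,a)` is allowed here).
[cite: DalzellHunterJonesBrandao2022, App. B proof of Theorem 8] -/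
theorem sum_touchCount_le : ∀ A : List (Gate n), ∑ j, touchCount A j ≤ 2 * A.length := by
  classical
  intro A
  induction A using List.reverseRecOn with
  | nil => simp [touchCount]
  | append_singleton A g ih =>
      simp only [touchCount_append, sum_add_distrib, List.length_append, List.length_singleton]
      have h2 : ∑ j, (if touches g j then 1 else 0) ≤ 2 := by
        rw [← sum_filter, sum_const, smul_eq_mul, mul_one]
        calc (univ.filter fun j => touches g j).card ≤ ({g.1, g.2} : Finset (Fin n)).card :=
              card_le_card fun j hj => by
                have := touches_iff.1 (mem_filter.1 hj).2
                rcases this with rfl | rfl <;> simp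
          _ ≤ 2 := card_le_two
      omega

/-! ## The two Jensen steps and Theorem 4 -/

/-- Jensen for `x ↦ qˣ` under the law of `γ⃗⁽ˢ⁾`: `q^{E|γ⃗⁽ˢ⁾|} ≤ E[q^{|γ⃗⁽ˢ⁾|}]`
(“by convexity of the exponential function, we have 𝔼[qˣ] ≥ q^{𝔼[x]}”).
[cite: DalzellHunterJonesBrandao2022, App. B proof of Theorem 8] -/
theorem rpow_sum_weight_le {q : ℝ} (hq : 0 < q) (A : List (Gate n)) :
    q ^ (∑ ν, bdist q A ν * (weight ν : ℝ)) ≤ ∑ ν, bdist q A ν * q ^ (weight ν : ℝ) := by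
  have h := geom_mean_le_arith_mean_weighted univ (bdist q A) (fun ν => q ^ (weight ν : ℝ))
    (fun ν _ => bdist_nonneg hq A ν) (sum_bdist hq A) (fun ν _ => by positivity)
  refine le_trans (le_of_eq ?_) h
  rw [rpow_sum_of_pos hq]
  refine prod_congr rfl fun ν _ => ?_
  rw [← rpow_mul hq.le, mul_comm]

/-- Jensen for `x ↦ cˣ` with uniform weights: `c^{(Σ_j s_j)/n} ≤ (1/n) Σ_j c^{s_j}` (“the minimum …
occurs when all the s_j are equal”). [cite: DalzellHunterJonesBrandao2022, App. B proof of Theorem 8] -/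
theorem rpow_avg_le_avg_rpow {c : ℝ} (hc : 0 < c) (hn : 0 < n) (s : Fin n → ℕ) :
    c ^ ((∑ j, (s j : ℝ)) / n) ≤ (∑ j, c ^ (s j : ℝ)) / n := by
  have hn' : (0 : ℝ) < n := by exact_mod_cast hn
  have h := geom_mean_le_arith_mean_weighted univ (fun _ : Fin n => (1 : ℝ) / n)
    (fun j => c ^ (s j : ℝ)) (fun _ _ => by positivity)
    (by rw [sum_const, card_univ, Fintype.card_fin, nsmul_eq_mul]; field_simp)
    (fun j _ => by positivity)
  have hl : ∏ j, (c ^ (s j : ℝ)) ^ ((1 : ℝ) / n) = c ^ ((∑ j, (s j : ℝ)) / n) := by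
    rw [sum_div, rpow_sum_of_pos hc]
    refine prod_congr rfl fun j _ => ?_
    rw [← rpow_mul hc.le]; ring_nf
  have hr : ∑ j, 1 / (n : ℝ) * c ^ (s j : ℝ) = (∑ j, c ^ (s j : ℝ)) / n := by
    rw [sum_div]; refine sum_congr rfl fun j _ => ?_; ring
  rw [hl, hr] at h
  exact h

/-- The lower bound on `E_b|γ⃗⁽ˢ⁾|`: `E|γ⃗⁽ˢ⁾| ≥ (n/(q+1)) (q²+1)^{−2s/n}`.
[cite: DalzellHunterJonesBrandao2022, App. B proof of Theorem 8 (display “𝔼[|γ⃗⁽ˢ⁾|] ≥ (1/(q+1)) n (1/(q²+1))^{2s/n}”)] -/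
theorem expected_weight_ge {q : ℝ} (hq : 0 < q) (hn : 0 < n) (A : List (Gate n)) :
    (n : ℝ) / (q + 1) * (1 / (q ^ 2 + 1)) ^ (2 * (A.length : ℝ) / n) ≤
      ∑ ν, bdist q A ν * (weight ν : ℝ) := by
  have hn' : (0 : ℝ) < n := by exact_mod_cast hn
  have hc : (0 : ℝ) < 1 / (q ^ 2 + 1) := by positivity
  have hc1 : 1 / (q ^ 2 + 1) ≤ (1 : ℝ) := by
    rw [div_le_one (by positivity)]; nlinarith [sq_nonneg q]
  rw [sum_bdist_weight_eq]
  -- Σ_j marginals ≥ (1/(q+1)) Σ_j c^{s_j}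
  have h1 : 1 / (q + 1) * ∑ j, (1 / (q ^ 2 + 1)) ^ (touchCount A j : ℝ) ≤
      ∑ j, siteMarginal q A j := by
    rw [mul_sum]
    refine sum_le_sum fun j _ => ?_
    rw [rpow_natCast]
    exact siteMarginal_ge hq j A
  -- Jensen: Σ_j c^{s_j} ≥ n c^{(Σ s_j)/n} ≥ n c^{2s/n}
  have h2 : (n : ℝ) * (1 / (q ^ 2 + 1)) ^ (2 * (A.length : ℝ) / n) ≤
      ∑ j, (1 / (q ^ 2 + 1)) ^ (touchCount A j : ℝ) := by
    have hJ := rpow_avg_le_avg_rpow hc hn (touchCount A)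
    rw [le_div_iff₀ hn'] at hJ
    have hexp : (∑ j, (touchCount A j : ℝ)) / n ≤ 2 * (A.length : ℝ) / n := by
      refine div_le_div_of_nonneg_right ?_ hn'.le
      have := sum_touchCount_le A
      exact_mod_cast this
    calc (n : ℝ) * (1 / (q ^ 2 + 1)) ^ (2 * (A.length : ℝ) / n)
        ≤ (n : ℝ) * (1 / (q ^ 2 + 1)) ^ ((∑ j, (touchCount A j : ℝ)) / n) :=
          mul_le_mul_of_nonneg_left (rpow_le_rpow_of_exponent_ge hc hc1 hexp) hn'.le
      _ ≤ ∑ j, (1 / (q ^ 2 + 1)) ^ (touchCount A j : ℝ) := by rw [mul_comm]; exact hJ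
  calc (n : ℝ) / (q + 1) * (1 / (q ^ 2 + 1)) ^ (2 * (A.length : ℝ) / n)
      = 1 / (q + 1) * ((n : ℝ) * (1 / (q ^ 2 + 1)) ^ (2 * (A.length : ℝ) / n)) := by ring
    _ ≤ 1 / (q + 1) * ∑ j, (1 / (q ^ 2 + 1)) ^ (touchCount A j : ℝ) :=
        mul_le_mul_of_nonneg_left h2 (by positivity)
    _ ≤ ∑ j, siteMarginal q A j := h1

/-- **Theorem 4 (general lower bound on the collision probability), exponent form**: for every
circuit diagram with `s` gates on `n ≥ 1` qudits of local dimension `q ≥ 1`,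
`Z ≥ q⁻ⁿ · q^{(n/(q+1)) (q²+1)^{−2s/n}}`.
[cite: DalzellHunterJonesBrandao2022, Theorem 4 (= Theorem 8, App. B §“Lower bound on collision probability”, middle line of the final display)] -/
theorem collisionZ_ge {q : ℝ} (hq : 1 ≤ q) (hn : 0 < n) (A : List (Gate n)) :
    (q ^ n)⁻¹ * q ^ ((n : ℝ) / (q + 1) * (1 / (q ^ 2 + 1)) ^ (2 * (A.length : ℝ) / n)) ≤
      collisionZ q A := by
  have hq0 : 0 < q := lt_of_lt_of_le one_pos hq
  have key : q ^ ((n : ℝ) / (q + 1) * (1 / (q ^ 2 + 1)) ^ (2 * (A.length : ℝ) / n)) ≤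
      ∑ ν, bdist q A ν * q ^ weight ν :=
    calc q ^ ((n : ℝ) / (q + 1) * (1 / (q ^ 2 + 1)) ^ (2 * (A.length : ℝ) / n))
        ≤ q ^ (∑ ν, bdist q A ν * (weight ν : ℝ)) :=
          rpow_le_rpow_of_exponent_le hq (expected_weight_ge hq0 hn A)
      _ ≤ ∑ ν, bdist q A ν * q ^ (weight ν : ℝ) := rpow_sum_weight_le hq0 A
      _ = ∑ ν, bdist q A ν * q ^ weight ν := by
          refine sum_congr rfl fun ν _ => ?_; rw [rpow_natCast]
  rw [collisionZ_eq_biased hq0]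
  calc (q ^ n)⁻¹ * q ^ ((n : ℝ) / (q + 1) * (1 / (q ^ 2 + 1)) ^ (2 * (A.length : ℝ) / n))
      ≤ (q ^ n)⁻¹ * ∑ ν, bdist q A ν * q ^ weight ν :=
        mul_le_mul_of_nonneg_left key (by positivity)
    _ = (∑ ν, bdist q A ν * q ^ weight ν) / q ^ n := by ring

/-- `Z_H/2 = 1/(qⁿ+1) ≤ q⁻ⁿ` (plumbing). [folklore] -/
private theorem haarZ_div_two_le {q : ℝ} (hq : 0 < q) : haarZ q n / 2 ≤ (q ^ n)⁻¹ := by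
  unfold haarZ
  have hqn : 0 < q ^ n := pow_pos hq n
  rw [div_div, inv_eq_one_div, div_le_div_iff₀ (by positivity) hqn]
  nlinarith

/-- **Theorem 4, as printed**:
`Z ≥ (Z_H/2) · exp( (log q/(q+1)) · exp( log n − (2s/n) log(q²+1) ) )`, `Z_H = 2/(qⁿ+1)`.
[cite: DalzellHunterJonesBrandao2022, Theorem 4 (= Theorem 8, App. B §“Lower bound on collision probability”)] -/
theorem collisionZ_ge_haar {q : ℝ} (hq : 1 ≤ q) (hn : 0 < n) (A : List (Gate n)) :
    haarZ q n / 2 * Real.exp (Real.log q / (q + 1) *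
      Real.exp (Real.log n - 2 * (A.length : ℝ) / n * Real.log (q ^ 2 + 1))) ≤
      collisionZ q A := by
  have hq0 : 0 < q := lt_of_lt_of_le one_pos hq
  have hn' : (0 : ℝ) < n := by exact_mod_cast hn
  have hc : (0 : ℝ) < q ^ 2 + 1 := by positivity
  refine le_trans ?_ (collisionZ_ge hq hn A)
  have hexp : Real.exp (Real.log q / (q + 1) *
      Real.exp (Real.log n - 2 * (A.length : ℝ) / n * Real.log (q ^ 2 + 1))) =
      q ^ ((n : ℝ) / (q + 1) * (1 / (q ^ 2 + 1)) ^ (2 * (A.length : ℝ) / n)) := by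
    have ht : (1 / (q ^ 2 + 1)) ^ (2 * (A.length : ℝ) / n) =
        (Real.exp (2 * (A.length : ℝ) / n * Real.log (q ^ 2 + 1)))⁻¹ := by
      rw [one_div, inv_rpow hc.le, rpow_def_of_pos hc]
      congr 2
      ring
    rw [Real.exp_sub, Real.exp_log hn', rpow_def_of_pos hq0, ht]
    congr 1
    ring
  rw [hexp]
  exact mul_le_mul_of_nonneg_right (haarZ_div_two_le hq0) (by positivity)

/-- **Corollary 3 in finite form**: if `Z ≤ 2 Z_H` (the source's criterion for
“anti-concentrated”) then `log n − log((q+1) log 4 / log q) ≤ (2s/n) log(q²+1)`, i.e.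
`s ≥ (2 log(q²+1))⁻¹ n log n − O(n)` with the `O(n)` term explicit (local dimension `q > 1`).
[cite: DalzellHunterJonesBrandao2022, Corollary 3 (App. B; “s_AC ≥ (2 log(q²+1))⁻¹ n log n − O(n)”)] -/
theorem log_le_of_collisionZ_le {q : ℝ} (hq : 1 < q) (hn : 0 < n) (A : List (Gate n))
    (hZ : collisionZ q A ≤ 2 * haarZ q n) :
    Real.log n - Real.log ((q + 1) * Real.log 4 / Real.log q) ≤
      2 * (A.length : ℝ) / n * Real.log (q ^ 2 + 1) := by
  have hq0 : 0 < q := lt_trans one_pos hq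
  have hlogq : 0 < Real.log q := Real.log_pos hq
  have hK : 0 < Real.log q / (q + 1) := by positivity
  have hZH : 0 < haarZ q n := by unfold haarZ; positivity
  have hlog4 : 0 < Real.log 4 := Real.log_pos (by norm_num)
  set L := Real.log n - 2 * (A.length : ℝ) / n * Real.log (q ^ 2 + 1) with hL
  have h := le_trans (collisionZ_ge_haar hq.le hn A) hZ
  -- exp(K e^L) ≤ 4
  have h4 : Real.exp (Real.log q / (q + 1) * Real.exp L) ≤ 4 := by
    have : haarZ q n / 2 * Real.exp (Real.log q / (q + 1) * Real.exp L) ≤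
        haarZ q n / 2 * 4 := by linarith
    exact le_of_mul_le_mul_left this (by positivity)
  -- K e^L ≤ log 4, hence e^L ≤ log 4 / K, hence L ≤ log (log 4 / K)
  have h5 : Real.log q / (q + 1) * Real.exp L ≤ Real.log 4 :=
    (Real.le_log_iff_exp_le (by norm_num)).2 h4
  have h6 : Real.exp L ≤ Real.log 4 / (Real.log q / (q + 1)) := by
    rw [le_div_iff₀ hK, mul_comm]; exact h5
  have h7 : L ≤ Real.log (Real.log 4 / (Real.log q / (q + 1))) :=
    (Real.le_log_iff_exp_le (by positivity)).2 h6
  have h8 : Real.log 4 / (Real.log q / (q + 1)) = (q + 1) * Real.log 4 / Real.log q := by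
    field_simp
  rw [h8] at h7
  rw [hL] at h7
  linarith


/-! ## Upper bound for deterministically regularly connected diagrams (Theorem 7)

The source's Theorem 7 (App. B §“Upper bound on collision probability”) bounds `Z` from above for
`r`-regularly connected architectures (Definition 5: conditioned on any prefix, with probability
`≥ 1/2` some gate among the next `rn` couples any given proper subset `R ⊂ [n]` to its complement).
Its proof has two ingredients: (i) “the sum of all the weights of all walks of any length that reach
a fixed point is precisely `Z_H`” (App. A §“Sanity check”, via the gambler's-ruin Lemma 1 /
Corollary 2), so the weight sitting at the fixed points `Iⁿ`, `Sⁿ` at any time is at most `Z_H`;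
(ii) a window of gates that crosses the `S`-set of a non-fixed configuration costs at least a factor
`2q/(q²+1)`.  Below, (i) is proved for every finite time by the optional-stopping identity behind
Corollary 2 — `P_S(x) = (q^{2x} − 1)/(q^{2n} − 1)` is harmonic for the biased walk, so
`E_b[P_S(|γ⃗⁽ᵗ⁾|)] = E_{Λ_b}[P_S] = 1/(qⁿ+1)` for all `t` — and (ii) verbatim; the theorem is then
stated for circuit diagrams whose consecutive windows each cross EVERY proper subset with certainty
(Definition 5 with probability one, as for the 1D architecture: “in 1D, it only takes two layers, or
`n` gates, to guarantee having performed a gate that crosses any partition”), for which the printed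
contraction factor `1/2 + (1/2)(2q/(q²+1))` improves to `2q/(q²+1)`; randomised architectures
(the complete-graph case of Definition 5) are NOT treated. -/

section UpperBound

/-- The trajectory sum started from a single configuration `γ⃗`: total weight of the trajectories
that begin at `γ⃗`, as a vector over their end points. [folklore] -/
def evolveFrom (q : ℝ) (A : List (Gate n)) (γ : Config n) : Config n → ℝ :=
  evolve q A (fun ν => if ν = γ then 1 else 0)

/-- `evolve` on a cons: the first gate is applied first (plumbing). [folklore] -/
private theorem evolve_cons (q : ℝ) (g : Gate n) (A : List (Gate n)) (v : Config n → ℝ) :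
    evolve q (g :: A) v = evolve q A (step q g v) := rfl

/-- `step` is linear (plumbing). [folklore] -/
private theorem step_sum_mul (q : ℝ) (g : Gate n) (v : Config n → ℝ) (w : Config n → Config n → ℝ)
    (ν : Config n) : step q g (fun γ' => ∑ γ, v γ * w γ γ') ν = ∑ γ, v γ * step q g (w γ) ν := by
  unfold step
  simp only [mul_sum]
  rw [sum_comm]
  refine sum_congr rfl fun γ _ => sum_congr rfl fun γ' _ => ?_
  ring

/-- `evolve` is linear in its start vector (plumbing). [folklore] -/
private theorem evolve_sum_mul (q : ℝ) :
    ∀ (B : List (Gate n)) (c : Config n → ℝ) (w : Config n → Config n → ℝ) ν',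
      evolve q B (fun γ' => ∑ γ, c γ * w γ γ') ν' = ∑ γ, c γ * evolve q B (w γ) ν' := by
  intro B
  induction B with
  | nil => intro c w ν'; simp
  | cons g' B ihB =>
      intro c w ν'
      rw [evolve_cons]
      have : step q g' (fun γ' => ∑ γ, c γ * w γ γ') = fun ν => ∑ γ, c γ * step q g' (w γ) ν := by
        funext ν; exact step_sum_mul q g' c w ν
      rw [this, ihB]
      rfl

/-- **Linearity of the trajectory sum**: the weight vector evolved from `v` is the `v`-weighted sum
of the vectors evolved from point masses (plumbing). [folklore] -/
private theorem evolve_eq_sum_evolveFrom (q : ℝ) (A : List (Gate n)) (v : Config n → ℝ) (ν : Config n) :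
    evolve q A v ν = ∑ γ, v γ * evolveFrom q A γ ν := by
  have hv : v = fun γ' => ∑ γ, v γ * (if γ' = γ then (1 : ℝ) else 0) := by
    funext γ'
    rw [Finset.sum_eq_single γ' (fun γ _ hγ => by simp [Ne.symm hγ]) (by simp)]
    simp
  conv_lhs => rw [hv]
  rw [evolve_sum_mul]
  rfl

/-- The total weight never increases along a diagram (plumbing form of `collisionZ_append_le`).
[folklore] -/
private theorem sum_evolve_le {q : ℝ} (hq : 0 ≤ q) :
    ∀ (A : List (Gate n)) (v : Config n → ℝ), (∀ γ, 0 ≤ v γ) → ∑ ν, evolve q A v ν ≤ ∑ γ, v γ := by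
  intro A
  induction A with
  | nil => intro v _; simp
  | cons g A ih =>
      intro v hv
      rw [evolve_cons]
      have hsv : ∀ γ, 0 ≤ step q g v γ :=
        fun γ => sum_nonneg fun γ' _ => mul_nonneg (transfer_nonneg hq g γ γ') (hv γ')
      exact (ih _ hsv).trans (sum_step_le q g hv)

/-- Every single-start trajectory bundle has total weight at most one (plumbing). [folklore] -/
private theorem sum_evolveFrom_le_one {q : ℝ} (hq : 0 ≤ q) (A : List (Gate n)) (γ : Config n) :
    ∑ ν, evolveFrom q A γ ν ≤ 1 := by
  unfold evolveFrom
  refine (sum_evolve_le hq A _ (fun ν => by positivity)).trans ?_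
  simp

/-- A window of gates *crosses* configuration `γ⃗` when one of its gates couples a site of
`R = {j : γ_j = S}` to a site outside `R` — the event of Definition 5 for the proper subset `R`.
[cite: DalzellHunterJonesBrandao2022, App. B Definition 5 (“there exists some index t′ … A⁽ᵗ′⁾ ∩ R ≠ ∅, and A⁽ᵗ′⁾ ⊄ R”)] -/
def Crosses (W : List (Gate n)) (γ : Config n) : Prop := ∃ g ∈ W, γ g.1 ≠ γ g.2

/-- A window is *connecting* when it crosses every proper nonempty `S`-set, i.e. every configuration
other than the fixed points `Iⁿ`, `Sⁿ` (Definition 5 with probability one: “in 1D, it only takes two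
layers, or n gates, to guarantee having performed a gate that crosses any partition one might
choose”). [cite: DalzellHunterJonesBrandao2022, App. B Definition 5 and the remark following it] -/
def Connecting (W : List (Gate n)) : Prop :=
  ∀ γ : Config n, γ ≠ (fun _ => false) → γ ≠ (fun _ => true) → Crosses W γ

/-- **A crossing window costs a factor `2q/(q²+1)`**: “if γ⃗⁽ᵗ⁾ is not at a fixed point … one of the
gates … matches an index in R with one in the complement of R. When this happens, a bit must be
flipped and the weight of that trajectory is reduced by factor `2q/(q²+1)`.”
[cite: DalzellHunterJonesBrandao2022, App. B proof of Theorem 7] -/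
theorem sum_evolveFrom_le_of_crosses {q : ℝ} (hq : 0 ≤ q) :
    ∀ (W : List (Gate n)) (γ : Config n), Crosses W γ →
      ∑ ν, evolveFrom q W γ ν ≤ 2 * q / (q ^ 2 + 1) := by
  intro W
  induction W with
  | nil => intro γ h; obtain ⟨g, hg, _⟩ := h; simp at hg
  | cons g W ih =>
      intro γ h
      unfold evolveFrom
      rw [evolve_cons]
      by_cases hγ : γ g.1 = γ g.2
      · -- the first gate does nothing to `δ_γ`; the crossing gate lies further in the window
        have hstep : step q g (fun ν => if ν = γ then (1 : ℝ) else 0) =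
            fun ν => if ν = γ then 1 else 0 := by
          funext ν
          unfold step
          rw [Finset.sum_eq_single γ (fun γ' _ hγ' => by simp [hγ']) (by simp)]
          rw [transfer_of_eq hγ]; simp
        rw [hstep]
        obtain ⟨g', hg', hne⟩ := h
        have hg'W : g' ∈ W := by
          rcases List.mem_cons.1 hg' with rfl | h'
          · exact absurd hγ hne
          · exact h'
        exact ih γ ⟨g', hg'W, hne⟩
      · -- the first gate flips a bit: total weight `2q/(q²+1)` right away, never more afterwards
        have hstep : step q g (fun ν => if ν = γ then (1 : ℝ) else 0) =
            fun ν => transfer q g ν γ := by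
          funext ν
          unfold step
          rw [Finset.sum_eq_single γ (fun γ' _ hγ' => by simp [hγ']) (by simp)]
          simp
        rw [hstep]
        calc ∑ ν, evolve q W (fun ν => transfer q g ν γ) ν ≤ ∑ ν, transfer q g ν γ :=
              sum_evolve_le hq W _ (fun ν => transfer_nonneg hq g ν γ)
          _ = 2 * q / (q ^ 2 + 1) := by rw [sum_transfer, if_neg hγ]

/-- **One connecting window**: if `W` crosses every non-fixed configuration then, for a nonnegative
weight vector `v` with fixed-point part `F = v(Iⁿ) + v(Sⁿ)` and total `T`, the total weight after the
window is at most `F + (2q/(q²+1))(T − F)`. [cite: DalzellHunterJonesBrandao2022, App. B proof of Theorem 7 (display “Z⁽ᵗ⁺ʳⁿ⁾ − Z_H ≤ (1/2 + (1/2)(2q/(q²+1)))(Z⁽ᵗ⁾ − Z_H)”, deterministic-crossing case)] -/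
theorem sum_evolve_connecting_le {q : ℝ} (hq : 0 ≤ q) (hn : 0 < n) {W : List (Gate n)}
    (hW : Connecting W) {v : Config n → ℝ} (hv : ∀ γ, 0 ≤ v γ) :
    ∑ ν, evolve q W v ν ≤ (v (fun _ => false) + v (fun _ => true)) +
      2 * q / (q ^ 2 + 1) * (∑ γ, v γ - (v (fun _ => false) + v (fun _ => true))) := by
  classical
  set I : Config n := fun _ => false with hI
  set S : Config n := fun _ => true with hS
  set c : ℝ := 2 * q / (q ^ 2 + 1) with hc
  have hc0 : 0 ≤ c := by rw [hc]; positivity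
  have hIS : I ≠ S := by
    intro h; have := congrFun h ⟨0, hn⟩; simp [hI, hS] at this
  -- total after the window = Σ_γ v γ · (mass of the bundle from γ)
  have htot : ∑ ν, evolve q W v ν = ∑ γ, v γ * ∑ ν, evolveFrom q W γ ν := by
    simp only [evolve_eq_sum_evolveFrom q W v, mul_sum]
    exact sum_comm
  rw [htot]
  -- bound each bundle: 1 for the two fixed points, `c` for the rest
  have hbound : ∀ γ, v γ * ∑ ν, evolveFrom q W γ ν ≤
      v γ * (if γ = I ∨ γ = S then 1 else c) := by
    intro γ
    refine mul_le_mul_of_nonneg_left ?_ (hv γ)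
    split_ifs with h
    · exact sum_evolveFrom_le_one hq W γ
    · simp only [not_or] at h
      exact sum_evolveFrom_le_of_crosses hq W γ (hW γ h.1 h.2)
  refine (sum_le_sum fun γ _ => hbound γ).trans (le_of_eq ?_)
  -- evaluate Σ_γ v γ · (1 on {I,S}, c elsewhere)
  have hset : univ.filter (fun γ : Config n => γ = I ∨ γ = S) = {I, S} := by ext γ; simp
  have hsplit := (sum_filter_add_sum_filter_not univ (fun γ : Config n => γ = I ∨ γ = S)
    (fun γ => v γ * if γ = I ∨ γ = S then (1 : ℝ) else c)).symm
  rw [hsplit]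
  have hF : ∑ γ ∈ univ.filter (fun γ : Config n => γ = I ∨ γ = S),
      v γ * (if γ = I ∨ γ = S then (1 : ℝ) else c) = v I + v S := by
    rw [hset, sum_pair hIS]; simp
  have hR : ∑ γ ∈ univ.filter (fun γ : Config n => ¬ (γ = I ∨ γ = S)),
      v γ * (if γ = I ∨ γ = S then (1 : ℝ) else c) =
      c * (∑ γ, v γ - (v I + v S)) := by
    have h1 : ∑ γ ∈ univ.filter (fun γ : Config n => ¬ (γ = I ∨ γ = S)),
        v γ * (if γ = I ∨ γ = S then (1 : ℝ) else c) =
        ∑ γ ∈ univ.filter (fun γ : Config n => ¬ (γ = I ∨ γ = S)), v γ * c :=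
      sum_congr rfl fun γ hγ => by rw [if_neg (mem_filter.1 hγ).2]
    have h2 : ∑ γ, v γ =
        (v I + v S) + ∑ γ ∈ univ.filter (fun γ : Config n => ¬ (γ = I ∨ γ = S)), v γ := by
      rw [← sum_filter_add_sum_filter_not univ (fun γ : Config n => γ = I ∨ γ = S) v]
      congr 1
      rw [hset, sum_pair hIS]
    rw [h1, ← sum_mul, h2]; ring
  rw [hF, hR]

/-! ### The harmonic function `P_S` and the fixed-point mass `≤ Z_H` at every finite time -/

/-- `P_S(x) = (q^{2x} − 1)/(q^{2n} − 1)`: the probability that the biased walk started at Hamming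
weight `x` is absorbed at `Sⁿ` (Corollary 2: `P_S(x) = q^{−2n+2x}(1 − q^{−2x})/(1 − q^{−2n})`).
[cite: DalzellHunterJonesBrandao2022, App. A Corollary 2] -/
def absorbS (q : ℝ) (n x : ℕ) : ℝ := (q ^ (2 * x) - 1) / (q ^ (2 * n) - 1)

/-- The printed form of Corollary 2 equals `(q^{2x} − 1)/(q^{2n} − 1)`.
[cite: DalzellHunterJonesBrandao2022, App. A Corollary 2] -/
theorem absorbS_eq_printed {q : ℝ} (hq : 1 < q) (hn : 0 < n) (x : ℕ) :
    absorbS q n x =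
      q ^ (2 * x) / q ^ (2 * n) * (1 - (q ^ (2 * x))⁻¹) / (1 - (q ^ (2 * n))⁻¹) := by
  unfold absorbS
  have hq0 : 0 < q := by linarith
  have hx : q ^ (2 * x) ≠ 0 := by positivity
  have hnn : q ^ (2 * n) ≠ 0 := by positivity
  have hn1 : q ^ (2 * n) - 1 ≠ 0 := by
    have : 1 < q ^ (2 * n) := one_lt_pow₀ hq (by omega)
    linarith
  have hn1' : 1 - (q ^ (2 * n))⁻¹ ≠ 0 := by
    intro h
    have : (q ^ (2 * n))⁻¹ = 1 := by linarith
    rw [inv_eq_one] at this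
    exact hn1 (by linarith)
  field_simp

/-- **`P_S` is harmonic for the biased walk**: `Σ_ν P_b(ν⃗|γ⃗) P_S(|ν⃗|) = P_S(|γ⃗|)` — from a
disagreeing pair the weight moves down with probability `q²/(q²+1)` and up with probability
`1/(q²+1)`, and `q² P_S(x−1) + P_S(x+1) = (q²+1) P_S(x)` (the recursion “Q(x) = (q/(q²+1))(Q(x−1) +
Q(x+1))” of Lemma 1 in its biased form). [cite: DalzellHunterJonesBrandao2022, App. A Lemma 1 (proof, recursion relation) and Corollary 2] -/
theorem sum_btransfer_absorbS {q : ℝ} (hq : 0 < q) (g : Gate n) (γ : Config n) :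
    ∑ ν, btransfer q g ν γ * absorbS q n (weight ν) = absorbS q n (weight γ) := by
  classical
  by_cases h : γ g.1 = γ g.2
  · simp only [btransfer_of_eq hq h]
    simp
  · have hsupp : ∀ ν, btransfer q g ν γ * absorbS q n (weight ν) =
        if ν = flipAt γ g.1 ∨ ν = flipAt γ g.2 then btransfer q g ν γ * absorbS q n (weight ν)
        else 0 := by
      intro ν
      split_ifs with hν
      · rfl
      · unfold btransfer; rw [transfer_of_ne h, if_neg hν]; simp
    rw [sum_congr rfl fun ν _ => hsupp ν, sum_ite_flip h,
      btransfer_flipAt hq h (Or.inl rfl), btransfer_flipAt hq h (Or.inr rfl),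
      weight_flipAt, weight_flipAt]
    have hq2 : q ^ 2 + 1 ≠ 0 := by positivity
    have key : ∀ x : ℕ, 1 ≤ x →
        q ^ 2 / (q ^ 2 + 1) * absorbS q n (x - 1) + 1 / (q ^ 2 + 1) * absorbS q n (x + 1) =
          absorbS q n x := by
      intro x hx
      unfold absorbS
      obtain ⟨y, rfl⟩ : ∃ y, x = y + 1 := ⟨x - 1, by omega⟩
      simp only [Nat.add_sub_cancel]
      rw [show 2 * (y + 1 + 1) = 2 * y + 4 by ring, show 2 * (y + 1) = 2 * y + 2 by ring,
        pow_add, pow_add]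
      by_cases hd : q ^ (2 * n) - 1 = 0
      · simp [hd]
      · field_simp
        ring
    have key' : ∀ x : ℕ, 1 ≤ x →
        1 / (q ^ 2 + 1) * absorbS q n (x + 1) + q ^ 2 / (q ^ 2 + 1) * absorbS q n (x - 1) =
          absorbS q n x := by
      intro x hx; rw [add_comm]; exact key x hx
    -- exactly one of the two sites carries `S`
    cases h1 : γ g.1 <;> cases h2 : γ g.2 <;> simp only [h1, h2] at h
    · exact absurd trivial h
    · simp only [Bool.false_eq_true, if_false, if_true]
      exact key' _ (one_le_weight_of_apply h2)
    · simp only [Bool.false_eq_true, if_false, if_true]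
      exact key _ (one_le_weight_of_apply h1)
    · exact absurd trivial h

/-- `E_{Λ_b}[q^{2|ν⃗|}] = qⁿ` (each site contributes `(q² + q)/(q+1) = q`). [folklore] -/
private theorem sum_biasedInit_mul_pow {q : ℝ} (hq : 0 < q) :
    ∑ ν : Config n, biasedInit q ν * q ^ (2 * weight ν) = q ^ n := by
  classical
  set f : Fin n → Bool → ℝ := fun _ b => siteLaw q b * if b = true then q ^ 2 else 1 with hf
  have hrw : ∀ ν : Config n, biasedInit q ν * q ^ (2 * weight ν) = ∏ j, f j (ν j) := by
    intro ν
    rw [hf]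
    show biasedInit q ν * q ^ (2 * weight ν) = ∏ j, (siteLaw q (ν j) * if ν j = true then q ^ 2 else 1)
    rw [biasedInit_eq_prod hq, prod_mul_distrib, prod_ite, prod_const, prod_const_one, mul_one,
      ← pow_mul]
    rfl
  simp only [hrw]
  rw [sum_prod_site]
  simp only [hf]
  have hsite : (∑ b, siteLaw q b * (if b = true then q ^ 2 else 1)) = q := by
    have hq1 : q + 1 ≠ 0 := by positivity
    simp only [Fintype.sum_bool, siteLaw, if_true, Bool.false_eq_true, if_false, mul_one]
    field_simp
  simp only [hsite, prod_const, card_univ, Fintype.card_fin]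

/-- **Optional stopping at finite time**: `E_{P_b,Λ_b}[P_S(|γ⃗⁽ᵗ⁾|)] = 1/(qⁿ+1)` for every diagram
— the finite-time content of “the sum of all the weights of all walks of any length that reach a
fixed point is precisely Z_H” (App. A §“Sanity check”). [cite: DalzellHunterJonesBrandao2022, App. A §“Sanity check: infinite circuit size convergence to Haar value” and Corollary 2] -/
theorem sum_bdist_absorbS {q : ℝ} (hq : 1 < q) (hn : 0 < n) :
    ∀ A : List (Gate n), ∑ ν, bdist q A ν * absorbS q n (weight ν) = 1 / (q ^ n + 1) := by
  have hq0 : 0 < q := by linarith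
  intro A
  induction A using List.reverseRecOn with
  | nil =>
      simp only [bdist_nil]
      unfold absorbS
      have hd : q ^ (2 * n) - 1 ≠ 0 := by
        have : 1 < q ^ (2 * n) := one_lt_pow₀ hq (by omega); linarith
      have hrw : ∀ ν : Config n, biasedInit q ν * ((q ^ (2 * weight ν) - 1) / (q ^ (2 * n) - 1)) =
          (biasedInit q ν * q ^ (2 * weight ν) - biasedInit q ν) / (q ^ (2 * n) - 1) := by
        intro ν; field_simp
      simp only [hrw, ← sum_div, sum_sub_distrib, sum_biasedInit_mul_pow hq0, sum_biasedInit hq0]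
      rw [show q ^ (2 * n) = (q ^ n) ^ 2 by rw [← pow_mul, mul_comm]]
      have : (q ^ n) ^ 2 - 1 = (q ^ n - 1) * (q ^ n + 1) := by ring
      rw [this]
      have hqn : 1 < q ^ n := one_lt_pow₀ hq (by omega)
      have h1 : q ^ n - 1 ≠ 0 := by linarith
      field_simp
  | append_singleton A g ih =>
      rw [bdist_append]
      unfold bstep
      simp only [sum_mul]
      rw [sum_comm]
      have : ∀ γ, ∑ ν, btransfer q g ν γ * bdist q A γ * absorbS q n (weight ν) =
          bdist q A γ * absorbS q n (weight γ) := by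
        intro γ
        rw [← sum_btransfer_absorbS hq0 g γ, mul_sum]
        refine sum_congr rfl fun ν _ => ?_; ring
      rw [sum_congr rfl fun γ _ => this γ, ih]

/-- `0 ≤ P_S(x) ≤ 1` for `x ≤ n` and `q > 1` (plumbing). [folklore] -/
private theorem absorbS_mem {q : ℝ} (hq : 1 < q) {x : ℕ} (hx : x ≤ n) :
    0 ≤ absorbS q n x ∧ absorbS q n x ≤ 1 := by
  unfold absorbS
  have h1 : 1 ≤ q ^ (2 * x) := one_le_pow₀ hq.le
  have h2 : q ^ (2 * x) ≤ q ^ (2 * n) := pow_le_pow_right₀ hq.le (by omega)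
  have hd : 0 ≤ q ^ (2 * n) - 1 := by linarith
  by_cases hd0 : q ^ (2 * n) - 1 = 0
  · simp [hd0]
  · have hd' : 0 < q ^ (2 * n) - 1 := lt_of_le_of_ne hd (Ne.symm hd0)
    constructor
    · exact div_nonneg (by linarith) hd
    · rw [div_le_one hd']; linarith

/-- The weight of `Sⁿ` is `n` (plumbing). [folklore] -/
private theorem weight_const_true : weight (fun _ : Fin n => true) = n := by
  unfold weight; simp

/-- The weight of `Iⁿ` is `0` (plumbing). [folklore] -/
private theorem weight_const_false : weight (fun _ : Fin n => false) = 0 := by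
  unfold weight; simp

/-- **The fixed points never hold more than the Haar value**: at every time `t`,
`Pr_b[γ⃗⁽ᵗ⁾ = Sⁿ] ≤ 1/(qⁿ+1)` and `Pr_b[γ⃗⁽ᵗ⁾ = Iⁿ] ≤ qⁿ/(qⁿ+1)`, hence the trajectory weight sitting
at `Iⁿ` and `Sⁿ` contributes at most `Z_H = 2/(qⁿ+1)` to `Z` (“the sum over walks that have reached
it before time step t is less than Z_H”). [cite: DalzellHunterJonesBrandao2022, App. B proof of Theorem 7] -/
theorem fixed_weight_le_haarZ {q : ℝ} (hq : 1 < q) (hn : 0 < n) (A : List (Gate n)) :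
    (evolve q A (fun _ => 1) (fun _ => false) + evolve q A (fun _ => 1) (fun _ => true)) /
      (q + 1) ^ n ≤ haarZ q n := by
  have hq0 : 0 < q := by linarith
  have hM := sum_bdist_absorbS hq hn A
  have hdn : q ^ (2 * n) - 1 ≠ 0 := by
    have : 1 < q ^ (2 * n) := one_lt_pow₀ hq (by omega); linarith
  -- P_t(Sⁿ) ≤ E[P_S] = 1/(qⁿ+1)
  have hPS : bdist q A (fun _ => true) ≤ 1 / (q ^ n + 1) := by
    rw [← hM]
    calc bdist q A (fun _ => true)
        = bdist q A (fun _ => true) * absorbS q n (weight (fun _ : Fin n => true)) := by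
          rw [weight_const_true]; unfold absorbS; rw [div_self hdn, mul_one]
      _ ≤ ∑ ν, bdist q A ν * absorbS q n (weight ν) :=
          single_le_sum (f := fun ν => bdist q A ν * absorbS q n (weight ν))
            (fun ν _ => mul_nonneg (bdist_nonneg hq0 A ν) (absorbS_mem hq (weight_le ν)).1)
            (mem_univ _)
  -- P_t(Iⁿ) ≤ E[1 − P_S] = qⁿ/(qⁿ+1)
  have hPI : bdist q A (fun _ => false) ≤ 1 - 1 / (q ^ n + 1) := by
    have hM' : ∑ ν, bdist q A ν * (1 - absorbS q n (weight ν)) = 1 - 1 / (q ^ n + 1) := by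
      simp only [mul_sub, mul_one, sum_sub_distrib, sum_bdist hq0 A, hM]
    rw [← hM']
    calc bdist q A (fun _ => false)
        = bdist q A (fun _ => false) * (1 - absorbS q n (weight (fun _ : Fin n => false))) := by
          rw [weight_const_false]; unfold absorbS; simp
      _ ≤ ∑ ν, bdist q A ν * (1 - absorbS q n (weight ν)) :=
          single_le_sum (f := fun ν => bdist q A ν * (1 - absorbS q n (weight ν)))
            (fun ν _ => mul_nonneg (bdist_nonneg hq0 A ν)
              (by linarith [(absorbS_mem hq (weight_le ν)).2])) (mem_univ _)
  -- translate the two probabilities back to trajectory weights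
  have hq1n : (q + 1) ^ n ≠ 0 := by positivity
  have hqn0 : q ^ n ≠ 0 := by positivity
  have hWI : evolve q A (fun _ => 1) (fun _ => false) =
      bdist q A (fun _ => false) * (q + 1) ^ n / q ^ n := by
    rw [bdist_eq hq0 A (fun _ => false), weight_const_false, pow_zero, div_one, div_pow]
    field_simp
  have hWS : evolve q A (fun _ => 1) (fun _ => true) = bdist q A (fun _ => true) * (q + 1) ^ n := by
    rw [bdist_eq hq0 A (fun _ => true), weight_const_true, div_pow]
    field_simp
  rw [hWI, hWS]
  unfold haarZ
  have hqn : 0 < q ^ n := by positivity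
  have hq1 : 0 < (q + 1) ^ n := by positivity
  have hqn1 : 0 < q ^ n + 1 := by positivity
  -- divide through by (q+1)ⁿ
  have hgoal : (bdist q A (fun _ => false) * (q + 1) ^ n / q ^ n +
      bdist q A (fun _ => true) * (q + 1) ^ n) / (q + 1) ^ n =
      bdist q A (fun _ => false) / q ^ n + bdist q A (fun _ => true) := by
    field_simp
  rw [hgoal]
  have h1 : bdist q A (fun _ => false) / q ^ n ≤ (1 - 1 / (q ^ n + 1)) / q ^ n :=
    div_le_div_of_nonneg_right hPI hqn.le
  have h3 : (1 - 1 / (q ^ n + 1)) / q ^ n = 1 / (q ^ n + 1) := by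
    field_simp; ring
  rw [h3] at h1
  have : (2 : ℝ) / (q ^ n + 1) = 1 / (q ^ n + 1) + 1 / (q ^ n + 1) := by ring
  rw [this]
  exact add_le_add h1 hPS

/-- **One connecting window contracts the excess over `Z_H`**:
`Z(A ++ W) − Z_H ≤ (2q/(q²+1)) (Z(A) − Z_H)`. [cite: DalzellHunterJonesBrandao2022, App. B proof of Theorem 7 (display “Z⁽ᵗ⁺ʳⁿ⁾ − Z_H ≤ …(Z⁽ᵗ⁾ − Z_H)”, deterministic-crossing case)] -/
theorem collisionZ_append_connecting_le {q : ℝ} (hq : 1 < q) (hn : 0 < n) (A : List (Gate n))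
    {W : List (Gate n)} (hW : Connecting W) :
    collisionZ q (A ++ W) - haarZ q n ≤ 2 * q / (q ^ 2 + 1) * (collisionZ q A - haarZ q n) := by
  have hq0 : 0 ≤ q := by linarith
  have hc1 : 2 * q / (q ^ 2 + 1) ≤ 1 := two_mul_div_sq_add_one_le_one q
  have hF := fixed_weight_le_haarZ hq hn A
  unfold collisionZ at hF ⊢
  rw [show evolve q (A ++ W) (fun _ => 1) = evolve q W (evolve q A (fun _ => 1)) by
    simp [evolve, List.foldl_append]]
  have hwin := sum_evolve_connecting_le hq0 hn hW
    (evolve_nonneg hq0 A (fun _ => 1) fun _ => zero_le_one)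
  have hpos : (0 : ℝ) < (q + 1) ^ n := by positivity
  set F := evolve q A (fun _ => 1) (fun _ => false) + evolve q A (fun _ => 1) (fun _ => true)
  set T := ∑ γ, evolve q A (fun _ => 1) γ
  set c := 2 * q / (q ^ 2 + 1)
  have h1 : (∑ ν, evolve q W (evolve q A fun _ => 1) ν) / (q + 1) ^ n ≤
      (F + c * (T - F)) / (q + 1) ^ n := div_le_div_of_nonneg_right hwin hpos.le
  have h2 : (F + c * (T - F)) / (q + 1) ^ n =
      (1 - c) * (F / (q + 1) ^ n) + c * (T / (q + 1) ^ n) := by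
    field_simp; ring
  rw [h2] at h1
  have h3 : (1 - c) * (F / (q + 1) ^ n) ≤ (1 - c) * haarZ q n :=
    mul_le_mul_of_nonneg_left hF (by linarith)
  linarith

/-- **Theorem 7 (upper bound), deterministic regularly connected form**: if the circuit diagram is a
concatenation of `m` windows each of which crosses every proper subset of the sites, then
`Z ≤ Z_H + (2q/(q²+1))^m · 2ⁿ/(q+1)ⁿ` (cf. the printed chain
“`Z⁽ˢ⁾ ≤ Z_H + (…)^{s/(rn)} (2ⁿ/(q+1)ⁿ − Z_H) ≤ Z_H + (…)^{s/(rn)} 2ⁿ/(q+1)ⁿ`”, with the factor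
`1/2 + (1/2)(2q/(q²+1))` of the probability-`1/2` Definition 5 replaced by `2q/(q²+1)` because the
windows cross with certainty). [cite: DalzellHunterJonesBrandao2022, Theorem 7 (App. B §“Upper bound on collision probability”, proof)] -/
theorem collisionZ_flatten_le {q : ℝ} (hq : 1 < q) (hn : 0 < n) :
    ∀ L : List (List (Gate n)), (∀ W ∈ L, Connecting W) →
      collisionZ q L.flatten ≤
        haarZ q n + (2 * q / (q ^ 2 + 1)) ^ L.length * (2 / (q + 1)) ^ n := by
  have hq0 : 0 ≤ q := by linarith
  have hc0 : 0 ≤ 2 * q / (q ^ 2 + 1) := by positivity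
  intro L
  induction L using List.reverseRecOn with
  | nil =>
      intro _
      simp only [List.flatten_nil, List.length_nil, pow_zero, one_mul, collisionZ_nil]
      have : 0 < haarZ q n := by unfold haarZ; positivity
      linarith
  | append_singleton L W ih =>
      intro hL
      have hW : Connecting W := hL W (by simp)
      have hL' : ∀ W' ∈ L, Connecting W' := fun W' h => hL W' (by simp [h])
      rw [List.flatten_append, List.flatten_singleton, List.length_append, List.length_singleton,
        pow_succ]
      have h1 := collisionZ_append_connecting_le hq hn L.flatten hW
      have h2 := ih hL'
      have h3 : 2 * q / (q ^ 2 + 1) * (collisionZ q L.flatten - haarZ q n) ≤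
          2 * q / (q ^ 2 + 1) * ((2 * q / (q ^ 2 + 1)) ^ L.length * (2 / (q + 1)) ^ n) :=
        mul_le_mul_of_nonneg_left (by linarith) hc0
      linarith

/-- The printed shape `Z ≤ Z_H (1 + (2q/(q+1))ⁿ c^m)`, using
“`2ⁿ(qⁿ+1)/(2(q+1)ⁿ) ≤ 2ⁿqⁿ/(q+1)ⁿ`”. [cite: DalzellHunterJonesBrandao2022, Theorem 7 (proof, last three lines of the display)] -/
theorem collisionZ_flatten_le_haar {q : ℝ} (hq : 1 < q) (hn : 0 < n) (L : List (List (Gate n)))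
    (hL : ∀ W ∈ L, Connecting W) :
    collisionZ q L.flatten ≤
      haarZ q n * (1 + (2 * q / (q + 1)) ^ n * (2 * q / (q ^ 2 + 1)) ^ L.length) := by
  have h := collisionZ_flatten_le hq hn L hL
  have hq0 : 0 < q := by linarith
  have hqn : 1 ≤ q ^ n := one_le_pow₀ hq.le
  have hc0 : 0 ≤ (2 * q / (q ^ 2 + 1)) ^ L.length := by positivity
  -- (2/(q+1))ⁿ ≤ Z_H (2q/(q+1))ⁿ  ⟸  qⁿ + 1 ≤ 2 qⁿ
  have hkey : (2 / (q + 1)) ^ n ≤ haarZ q n * (2 * q / (q + 1)) ^ n := by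
    unfold haarZ
    rw [div_pow, div_pow, mul_pow, div_mul_div_comm, div_le_div_iff₀ (by positivity) (by positivity)]
    have h' : (q ^ n + 1) ≤ 2 * q ^ n := by linarith
    have h2 : (0:ℝ) < 2 ^ n := by positivity
    have h3 : (0:ℝ) < (q + 1) ^ n := by positivity
    have h4 := mul_le_mul_of_nonneg_left h' (le_of_lt (mul_pos h2 h3))
    linarith [h4]
  calc collisionZ q L.flatten
      ≤ haarZ q n + (2 * q / (q ^ 2 + 1)) ^ L.length * (2 / (q + 1)) ^ n := h
    _ ≤ haarZ q n + (2 * q / (q ^ 2 + 1)) ^ L.length * (haarZ q n * (2 * q / (q + 1)) ^ n) := by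
        gcongr
    _ = haarZ q n * (1 + (2 * q / (q + 1)) ^ n * (2 * q / (q ^ 2 + 1)) ^ L.length) := by ring

end UpperBound


/-! ## Connected coupling graphs and the 1D architecture (v3)

Which windows are `Connecting`?  Exactly as the remark after Definition 5 says for 1D (“In 1D, it
only takes two layers, or `n` gates, to guarantee having performed a gate that crosses any partition
one might choose”): a window crosses every partition as soon as the graph on the sites formed by its
gates is connected.  This section proves that criterion and instantiates the deterministic form of
Theorem 7 (`collisionZ_flatten_le_haar`) for the 1D architecture of Definition 2 (a ring, two
alternating layers) and for its open-boundary variant (App. C: “We assume periodic boundary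
conditions, although it would be possible to consider open boundary conditions as well”). -/

section ConnectedWindows

/-- The coupling graph of a window: sites `a ≠ b` are adjacent when some gate of the window acts on
the pair `{a, b}`. [folklore] -/
def couplingGraph (W : List (Gate n)) : SimpleGraph (Fin n) where
  Adj a b := a ≠ b ∧ ((a, b) ∈ W ∨ (b, a) ∈ W)
  symm := ⟨fun _ _ h => ⟨h.1.symm, h.2.symm⟩⟩
  loopless := ⟨fun _ h => h.1 rfl⟩

/-- Along a walk between two sites carrying different values some edge carries different values
(plumbing). [folklore] -/
private theorem exists_adj_ne_of_walk {G : SimpleGraph (Fin n)} (γ : Config n) :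
    ∀ {a b : Fin n} (_ : G.Walk a b), γ a ≠ γ b → ∃ c d, G.Adj c d ∧ γ c ≠ γ d
  | _, _, SimpleGraph.Walk.nil, h => absurd rfl h
  | a, _, SimpleGraph.Walk.cons (v := a') hadj w, h => by
      by_cases h' : γ a = γ a'
      · exact exists_adj_ne_of_walk γ w (fun e => h (h'.trans e))
      · exact ⟨a, a', hadj, h'⟩

/-- **A window whose coupling graph is connected crosses every partition** — the deterministic
(probability-one, `t' ≤ t + |W|`) case of the event in Definition 5: for every proper subset `R` of
sites with value `S`, some gate `A⁽ᵗ'⁾` of the window has `A⁽ᵗ'⁾ ∩ R ≠ ∅` and `A⁽ᵗ'⁾ ⊄ R`.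
[cite: DalzellHunterJonesBrandao2022, App. B Definition 5 and the remark following it (“given any partition of the qudits into two sets, we should expect at least one gate to couple a qudit from one set with a qudit from the other set”)] -/
theorem connecting_of_preconnected {W : List (Gate n)} (hW : (couplingGraph W).Preconnected) :
    Connecting W := by
  intro γ hI hS
  obtain ⟨a, ha⟩ : ∃ a, γ a = true := by
    by_contra h
    apply hI
    funext j
    cases hj : γ j
    · rfl
    · exact absurd ⟨j, hj⟩ h
  obtain ⟨b, hb⟩ : ∃ b, γ b = false := by
    by_contra h
    apply hS
    funext j
    cases hj : γ j
    · exact absurd ⟨j, hj⟩ h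
    · rfl
  obtain ⟨w⟩ := hW a b
  obtain ⟨c, d, hadj, hne⟩ := exists_adj_ne_of_walk γ w (by rw [ha, hb]; decide)
  rcases hadj.2 with h | h
  · exact ⟨(c, d), h, hne⟩
  · exact ⟨(d, c), h, fun e => hne e.symm⟩

/-- **Theorem 7, deterministic form, for a repeated connecting window**: `d` repetitions of a window
`W` that crosses every partition give `Z ≤ Z_H (1 + (2q/(q+1))ⁿ (2q/(q²+1))ᵈ)`, i.e. the printed
shape `Z ≤ Z_H (1 + e^{−(2a/n)(s − s*)})` with `s = d·|W|`, `a = (n / 2|W|) log((q²+1)/(2q))` and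
`s* = (2a)⁻¹ log(2q/(q+1)) n²` (no `O(n)`: the factor `(qⁿ+1)/2 ≤ qⁿ` is absorbed as in the
printed chain of inequalities). [cite: DalzellHunterJonesBrandao2022, Theorem 7 (App. B) and its proof (“Z⁽ᵗ⁺ʳⁿ⁾ − Z_H ≤ (1/2 + (1/2)·2q/(q²+1))(Z⁽ᵗ⁾ − Z_H)”, here with the crossing certain, factor 2q/(q²+1))] -/
theorem collisionZ_replicate_le {q : ℝ} (hq : 1 < q) (hn : 0 < n) {W : List (Gate n)}
    (hW : Connecting W) (d : ℕ) :
    collisionZ q (List.replicate d W).flatten ≤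
      haarZ q n * (1 + (2 * q / (q + 1)) ^ n * (2 * q / (q ^ 2 + 1)) ^ d) := by
  have h := collisionZ_flatten_le_haar hq hn (List.replicate d W)
    (fun W' hW' => by rw [List.eq_of_mem_replicate hW']; exact hW)
  rwa [List.length_replicate] at h

/-- A list of bonds rearranged as its layer of “even” bonds (first site even) followed by its layer
of “odd” bonds — the order in which Definition 2 applies them. [folklore] -/
def twoLayers (B : List (Gate n)) : List (Gate n) :=
  B.filter (fun g => g.1.val % 2 = 0) ++ B.filter (fun g => g.1.val % 2 = 1)

/-- Rearranging into two layers keeps every bond (plumbing). [folklore] -/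
private theorem mem_twoLayers {B : List (Gate n)} {g : Gate n} (h : g ∈ B) : g ∈ twoLayers B := by
  unfold twoLayers
  rw [List.mem_append, List.mem_filter, List.mem_filter]
  rcases Nat.mod_two_eq_zero_or_one g.1.val with h0 | h1
  · exact Or.inl ⟨h, by simp [h0]⟩
  · exact Or.inr ⟨h, by simp [h1]⟩

/-- If a bond list contains every nearest-neighbour bond `(i, i+1)`, the coupling graph of its two
layers contains the path graph (plumbing). [folklore] -/
private theorem pathGraph_le_couplingGraph_twoLayers {B : List (Gate n)}
    (hB : ∀ a b : Fin n, b.val = a.val + 1 → (a, b) ∈ B) :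
    SimpleGraph.pathGraph n ≤ couplingGraph (twoLayers B) := by
  intro u v huv
  rw [SimpleGraph.pathGraph_adj] at huv
  refine ⟨fun e => ?_, ?_⟩
  · subst e; omega
  · rcases huv with h | h
    · exact Or.inl (mem_twoLayers (hB u v h.symm))
    · exact Or.inr (mem_twoLayers (hB v u h.symm))

/-- **Two layers containing every nearest-neighbour bond cross every partition** (“In 1D, it only
takes two layers, or n gates, to guarantee having performed a gate that crosses any partition one
might choose”). [cite: DalzellHunterJonesBrandao2022, App. B, remark after Definition 5] -/
theorem connecting_twoLayers {B : List (Gate n)}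
    (hB : ∀ a b : Fin n, b.val = a.val + 1 → (a, b) ∈ B) : Connecting (twoLayers B) :=
  connecting_of_preconnected ((SimpleGraph.pathGraph_preconnected n).mono
    (pathGraph_le_couplingGraph_twoLayers hB))

/-- The bonds of the ring on `n` sites, `(i, i+1 mod n)` for every site `i` (0-indexed; the source's
“index n is identified with index 0 to enforce periodic boundary conditions”). [cite: DalzellHunterJonesBrandao2022, §7 Definition 2 (1D architecture)] -/
def ringBonds (n : ℕ) : List (Gate n) :=
  (List.finRange n).map fun i => (i, ⟨(i.val + 1) % n, Nat.mod_lt _ i.pos⟩)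

/-- **The 1D architecture's pair of layers (Definition 2)**: on a ring of `n` sites, the layer of
bonds `{2t−1, 2t}` followed by the layer `{2t, 2t+1}` (1-indexed, `t = 1,…,n/2`, index `n ≡ 0`) —
here 0-indexed as the even bonds `(0,1),(2,3),…` then the odd bonds `(1,2),(3,4),…,(n−1,0)`; the
source assumes `n` even, the definition makes sense for every `n`. A 1D circuit of depth `2d` is
`(List.replicate d (ringWindow n)).flatten`. [cite: DalzellHunterJonesBrandao2022, §7 Definition 2 (1D architecture: “alternating between the two types of layers of n/2 non-overlapping nearest-neighbor two-qudit gates on a ring”)] -/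
def ringWindow (n : ℕ) : List (Gate n) := twoLayers (ringBonds n)

/-- The ring contains every bond `(i, i+1)` (plumbing). [folklore] -/
private theorem mem_ringBonds {a b : Fin n} (h : b.val = a.val + 1) : (a, b) ∈ ringBonds n := by
  unfold ringBonds
  rw [List.mem_map]
  refine ⟨a, List.mem_finRange a, ?_⟩
  simp only [Prod.mk.injEq, true_and]
  exact Fin.ext (show (a.val + 1) % n = b.val by rw [← h]; exact Nat.mod_eq_of_lt b.isLt)

/-- **In 1D two layers (n gates) cross every partition.**
[cite: DalzellHunterJonesBrandao2022, App. B, remark after Definition 5 (“In 1D, it only takes two layers, or n gates, to guarantee having performed a gate that crosses any partition one might choose”)] -/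
theorem connecting_ringWindow : Connecting (ringWindow n) :=
  connecting_twoLayers fun _ _ h => mem_ringBonds h

/-- **Theorem 7 for the 1D architecture (Definition 2), deterministic form**: after `2d` layers on
`n ≥ 1` qudits of local dimension `q > 1`, `Z ≤ Z_H (1 + (2q/(q+1))ⁿ (2q/(q²+1))ᵈ)`; in particular
`Z ≤ 2 Z_H` once `d ≥ n log(2q/(q+1)) / log((q²+1)/(2q))` — the linear-depth (`s* = Θ(n²)`)
guarantee of Theorem 3 / Theorem 7 specialised to 1D.  The sharp 1D statement (Theorem 1: depth
`Θ(log n)` suffices) rests on the domain-wall analysis of App. C and is NOT proved here.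
[cite: DalzellHunterJonesBrandao2022, Theorem 7 (App. B) with Definition 2; main text Theorem 3 (“a = Θ(1) and s* = Θ(n²)”)] -/
theorem collisionZ_ring_le {q : ℝ} (hq : 1 < q) (hn : 0 < n) (d : ℕ) :
    collisionZ q (List.replicate d (ringWindow n)).flatten ≤
      haarZ q n * (1 + (2 * q / (q + 1)) ^ n * (2 * q / (q ^ 2 + 1)) ^ d) :=
  collisionZ_replicate_le hq hn connecting_ringWindow d

/-- The nearest-neighbour bonds `(i, i+1)`, `i + 1 < n`, of the OPEN chain on `n` sites. [folklore] -/
def chainBonds (n : ℕ) : List (Gate n) :=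
  (List.finRange n).filterMap fun i =>
    if h : i.val + 1 < n then some (i, ⟨i.val + 1, h⟩) else none

/-- Membership in `chainBonds`: exactly the pairs `(i, i+1)` (plumbing). [folklore] -/
private theorem mem_chainBonds {a b : Fin n} : (a, b) ∈ chainBonds n ↔ b.val = a.val + 1 := by
  unfold chainBonds
  rw [List.mem_filterMap]
  constructor
  · rintro ⟨i, _, hi⟩
    by_cases h : i.val + 1 < n
    · rw [dif_pos h] at hi
      simp only [Option.some.injEq, Prod.mk.injEq] at hi
      obtain ⟨rfl, rfl⟩ := hi
      rfl
    · rw [dif_neg h] at hi; simp at hi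
  · intro h
    have ha : a.val + 1 < n := h ▸ b.isLt
    refine ⟨a, List.mem_finRange a, ?_⟩
    rw [dif_pos ha]
    simp only [Option.some.injEq, Prod.mk.injEq, true_and]
    exact Fin.ext h.symm

/-- The open-boundary variant of Definition 2's pair of layers: even bonds `(0,1),(2,3),…` then odd
bonds `(1,2),(3,4),…` of the open chain (`n − 1` gates). [cite: DalzellHunterJonesBrandao2022, §7 Definition 2 with the open boundary conditions of App. C (“it would be possible to consider open boundary conditions as well”)] -/
def brickworkWindow (n : ℕ) : List (Gate n) := twoLayers (chainBonds n)

/-- **Two open-chain layers cross every partition** (the coupling graph is the path).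
[cite: DalzellHunterJonesBrandao2022, App. B, remark after Definition 5] -/
theorem connecting_brickworkWindow : Connecting (brickworkWindow n) :=
  connecting_twoLayers fun _ _ h => mem_chainBonds.2 h

/-- **Theorem 7 for the open-boundary 1D brickwork, deterministic form**: after `2d` layers,
`Z ≤ Z_H (1 + (2q/(q+1))ⁿ (2q/(q²+1))ᵈ)`. [cite: DalzellHunterJonesBrandao2022, Theorem 7 (App. B) with Definition 2 (open boundary, App. C)] -/
theorem collisionZ_brickwork_le {q : ℝ} (hq : 1 < q) (hn : 0 < n) (d : ℕ) :
    collisionZ q (List.replicate d (brickworkWindow n)).flatten ≤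
      haarZ q n * (1 + (2 * q / (q + 1)) ^ n * (2 * q / (q ^ 2 + 1)) ^ d) :=
  collisionZ_replicate_le hq hn connecting_brickworkWindow d

end ConnectedWindows


/-! ## Checks and corollaries (v4)

Three small consequences recorded for the lane's use: the transfer rule reproduces the Haar value
exactly for a single two-qudit gate on two qudits (the `n = 2` case of “when the circuit unitary
`U` becomes a globally Haar-random `qⁿ × qⁿ` unitary … `Z_H = 2/(qⁿ+1)`”), Theorem 4 at `q = 2`
in the form `2ⁿZ ≥ 2^{(n/3)5^{−2s/n}}` that the source uses against Barak–Chou–Gao's conjecture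
(“`2ⁿZ ≥ exp(n^{1−o(1)})` when `d` is sublogarithmic” — `2ⁿZ` is the factor in their spoofing
runtime, see `XEBSampleComplexity.lean`), and Theorem 7's deterministic form stated directly for
windows with connected coupling graphs (any layered architecture whose couplers over a window
form a connected graph, e.g. a full cycle of a 2D grid pattern). -/

section Checks

/-- Total weight after one gate, column by column (plumbing). [folklore] -/
private theorem sum_step_eq (q : ℝ) (g : Gate n) (v : Config n → ℝ) :
    ∑ ν, step q g v ν = ∑ γ, (if γ g.1 = γ g.2 then 1 else 2 * q / (q ^ 2 + 1)) * v γ := by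
  unfold step
  rw [sum_comm]
  refine sum_congr rfl fun γ _ => ?_
  rw [← sum_mul, sum_transfer]

/-- On two qudits, two of the four configurations have equal entries (plumbing). [folklore] -/
private theorem card_config_two_eq :
    (univ.filter fun γ : Config 2 => γ 0 = γ 1).card = 2 := by decide

/-- … and two have different entries (plumbing). [folklore] -/
private theorem card_config_two_ne :
    (univ.filter fun γ : Config 2 => ¬ γ 0 = γ 1).card = 2 := by decide

/-- **One Haar-random two-qudit gate on two qudits gives exactly the Haar value `Z_H = 2/(q²+1)`**:
the `n = 2`, `s = 1` instance of “when the circuit unitary U becomes a globally Haar-random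
qⁿ × qⁿ unitary … Z_H := 2/(qⁿ+1)” — here a CHECK that the displayed transfer rule, taken as the
definition of `Z`, reproduces it (`Σ_ν (T𝟙)(ν) = 2·1 + 2·2q/(q²+1) = 2(q+1)²/(q²+1)`).
[cite: DalzellHunterJonesBrandao2022, §2 eq. “lim_{s→∞} Z = Z_H := 2/(qⁿ+1)” and the sentence before it] -/
theorem collisionZ_single_gate_two (q : ℝ) (hq : 0 ≤ q) :
    collisionZ q [((0 : Fin 2), (1 : Fin 2))] = haarZ q 2 := by
  unfold collisionZ haarZ
  rw [show evolve q [((0 : Fin 2), (1 : Fin 2))] (fun _ => (1 : ℝ)) =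
      step q ((0 : Fin 2), (1 : Fin 2)) (fun _ => 1) from rfl, sum_step_eq]
  simp only [mul_one]
  rw [sum_ite, sum_const, sum_const, card_config_two_eq, card_config_two_ne]
  have h1 : (q ^ 2 + 1) ≠ 0 := by positivity
  have h2 : (q + 1) ^ 2 ≠ 0 := by positivity
  rw [nsmul_eq_mul, nsmul_eq_mul, Nat.cast_ofNat, mul_one, ← mul_div_assoc, div_eq_div_iff h2 h1,
    add_mul, div_mul_cancel₀ _ h1]
  ring

/-- **Theorem 4 at `q = 2`: `2ⁿ Z ≥ 2^{(n/3)·5^{−2s/n}}`** for every diagram of `s` gates on `n ≥ 1`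
qubits — with depth `d ≥ 2s/n`, `2ⁿZ ≥ exp((log 2/3)·n·5^{−d})`, which is `exp(n^{1−o(1)})` for
sublogarithmic depth; `2ⁿZ` is the factor governing Barak–Chou–Gao's spoofing runtime.
[cite: DalzellHunterJonesBrandao2022, §4 (“Our Theorem 4 contradicts their conjecture by showing generally that 2ⁿZ ≥ exp(n^{1−o(1)}) when d is sublogarithmic”) with Theorem 4] -/
theorem two_pow_mul_collisionZ_ge (hn : 0 < n) (A : List (Gate n)) :
    (2 : ℝ) ^ ((n : ℝ) / 3 * (1 / 5) ^ (2 * (A.length : ℝ) / n)) ≤ 2 ^ n * collisionZ 2 A := by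
  have h := collisionZ_ge (q := (2 : ℝ)) (by norm_num) hn A
  have h3 : ((n : ℝ) / (2 + 1) * (1 / (2 ^ 2 + 1)) ^ (2 * (A.length : ℝ) / n)) =
      (n : ℝ) / 3 * (1 / 5) ^ (2 * (A.length : ℝ) / n) := by norm_num
  rw [h3] at h
  have h2 : (0 : ℝ) < 2 ^ n := by positivity
  calc (2 : ℝ) ^ ((n : ℝ) / 3 * (1 / 5) ^ (2 * (A.length : ℝ) / n))
      = 2 ^ n * ((2 ^ n)⁻¹ * (2 : ℝ) ^ ((n : ℝ) / 3 * (1 / 5) ^ (2 * (A.length : ℝ) / n))) := by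
        rw [← mul_assoc, mul_inv_cancel₀ h2.ne', one_mul]
    _ ≤ 2 ^ n * collisionZ 2 A := mul_le_mul_of_nonneg_left h h2.le

/-- **Theorem 7, deterministic form, for windows with connected coupling graphs**: a diagram made
of `m` windows, each of whose gates form a connected graph on all `n` sites, has
`Z ≤ Z_H(1 + (2q/(q+1))ⁿ(2q/(q²+1))^m)` — the form that applies to any layered architecture whose
couplers over a window connect all qudits (1D: two layers, `connecting_ringWindow`; a 2D pattern:
one full cycle of its layers). [cite: DalzellHunterJonesBrandao2022, Theorem 7 (App. B) with Definition 5 and the remark after it (“Most natural architectures we might consider have this property”)] -/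
theorem collisionZ_flatten_le_haar_of_preconnected {q : ℝ} (hq : 1 < q) (hn : 0 < n)
    (L : List (List (Gate n))) (hL : ∀ W ∈ L, (couplingGraph W).Preconnected) :
    collisionZ q L.flatten ≤
      haarZ q n * (1 + (2 * q / (q + 1)) ^ n * (2 * q / (q ^ 2 + 1)) ^ L.length) :=
  collisionZ_flatten_le_haar hq hn L fun W hW => connecting_of_preconnected (hL W hW)

end Checks

end RandomCircuitCollision

end Literature.Computability.QuantumComplexity
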